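import Literature.NumberTheory.Sieve.HeathBrownPrincipalEstimateTools

/-!
# The core of Heath-Brown's principal estimate (HB86 Lemma 5), residue-level form

Source: D. R. Heath-Brown, *The divisor function `d₃(n)` in arithmetic progressions*, Acta Arith. 47
(1986) 29–56, §4 [cite: HeathBrown1986d3].  No named facts are introduced.

* **Core of Lemma 5** (`core_lemma5`): for functions `F₁, F₂, F₃` on `ℤ/qℤ` with
  `‖Fᵢ(r)‖ ≤ min(I, q/|r|)`-type bounds, `‖∑_{r,s,t ≠ 0} K₂(r,s,at;q) F₁F₂F₃‖ ≤ 4 (log₂ q + 1)³ 64^{ω(q)} W`,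
  `W = √maxd (32 √(A q^{-5/6}) d(q) q³ + 12 √(AL) d(q) q² √(IJ) + 12 √M √K q^{5/2})` (`Wconst`), given the
  `(4.7)`-shaped off-diagonal bound `hoff` (constants `A, L`) and the `(3.1)`-shaped diagonal bound
  `hdiag` (constant `M`).  With `A ≍ d_A(q) q^{5/2}`, `L ≍ d(q) log q`, `M ≍ (q d₃(q))²`, `maxd ≪ q^ε`
  this is HB's `q^{3+ε}(q^{5/6} + q^{1/4}(IJ)^{1/2} + q^{1/2}K^{1/2})`.  Proof as in HB §4 at the level of
  residues: dyadic blocks, `r = ±ρ(r) r'(r)` (`rho`, `rcop`, `K2_eq_K2_srho`), regrouping by `h = r's'`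
  with multiplicity `≤ d(h)` (`sum_fiber_le_maxd_mul`), Cauchy–Schwarz on each fibre (`fiber_sum_le`),
  the count `∑_{t₁≠t₂ ∈ block} √((t₁,q)(t₂,q))(t₁−t₂,q) ≤ 32 (d(q)T)²` (`sum_offdiag_weight_le`),
  Heath-Brown's four inequalities (`fibre_analytic`), and `∑_{ρ q-smooth} ρ^{-1/4} ≤ 8^{ω(q)}`
  (`sum_smooth_quarter_le`, replacing (4.2)).
* **(4.7), abstract form** (`KK_bound_of_L4`): from a bound `|S(k,t;ρ,σ;q)| ≤ A₄ · L4shape` (Lemma 4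
  without the factor `d_A(q) q^{5/2}`) one gets `hoff` with `A = A₄`, `L = d(q)(1 + log q)`
  (completion `mul_sum_K2_conj_eq_sum_SS`, geometric sums, `∑_k (k²,q)^{1/2}/k ≤ d(q)(1+log q)`).
* **The diagonal hypothesis** from Deligne's prime bound (`K2_sq_le_of_deligne`, via (3.1) =
  `K2_bound_of_deligne`).
-/

open Finset

namespace Literature.NumberTheory.Sieve.HeathBrown1986

open Literature.NumberTheory.Sieve.Vinogradov (distInt distInt_nonneg)
open Literature.NumberTheory.Sieve.FouvryTenenbaum2021 (lemma412_norm_sum_Ioc_stdAddChar_le)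

variable {q : ℕ} [NeZero q]

/-! ### More on `d0` -/

/-- `(t.val, q) = (d0 t, q)`. [folklore] -/
theorem gcd_val_eq_gcd_d0 (t : ZMod q) : Nat.gcd t.val q = Nat.gcd (d0 t) q := by
  have hv : t.val < q := ZMod.val_lt t
  unfold d0
  rcases le_total t.val (q - t.val) with h | h
  · rw [min_eq_left h]
  · rw [min_eq_right h]
    rw [Nat.gcd_self_sub_left hv.le]

/-- `d0 t ≤ |z|` for every integer lift `z` of `t`. [folklore] -/
theorem d0_le_natAbs_of_intCast_eq {z : ℤ} {t : ZMod q} (h : (z : ZMod q) = t) : d0 t ≤ z.natAbs := by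
  have hq : (0 : ℤ) < q := by exact_mod_cast Nat.pos_of_ne_zero (NeZero.ne q)
  have hv : (t.val : ℤ) = z % q := by rw [← h, ZMod.val_intCast]
  have hdecomp := Int.emod_add_mul_ediv z q
  have hmod0 : 0 ≤ z % q := Int.emod_nonneg z hq.ne'
  have hmodq : z % q < q := Int.emod_lt_of_pos z hq
  have hvlt : t.val < q := ZMod.val_lt t
  unfold d0
  -- case on the sign of `z / q`
  rcases lt_trichotomy (z / q) 0 with hk | hk | hk
  · -- `z ≤ -q + v`, so `|z| ≥ q - v`
    have hz : z ≤ -(q : ℤ) + z % q := by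
      have : (q : ℤ) * (z / q) ≤ (q : ℤ) * (-1) := mul_le_mul_of_nonneg_left (by omega) hq.le
      linarith
    have : ((q - t.val : ℕ) : ℤ) ≤ z.natAbs := by
      rw [Nat.cast_sub hvlt.le, Int.natCast_natAbs]
      have : |z| ≥ -z := neg_le_abs z
      linarith
    exact (min_le_right _ _).trans (by exact_mod_cast this)
  · have hz : z = z % q := by rw [hk, mul_zero, add_zero] at hdecomp; exact hdecomp.symm
    have : ((t.val : ℕ) : ℤ) ≤ z.natAbs := by
      rw [Int.natCast_natAbs, hv]; rw [← hz]; exact le_abs_self z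
    exact (min_le_left _ _).trans (by exact_mod_cast this)
  · have hz : z % q + q ≤ z := by
      have : (q : ℤ) * 1 ≤ (q : ℤ) * (z / q) := mul_le_mul_of_nonneg_left (by omega) hq.le
      linarith
    have : ((t.val : ℕ) : ℤ) ≤ z.natAbs := by
      rw [Int.natCast_natAbs, hv]
      have : z % q ≤ z := by linarith
      exact this.trans (le_abs_self z)
    exact (min_le_left _ _).trans (by exact_mod_cast this)

/-- **Triangle inequality for `d0`**: `d0 (x + y) ≤ d0 x + d0 y`. [folklore] -/
theorem d0_add_le (x y : ZMod q) : d0 (x + y) ≤ d0 x + d0 y := by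
  have h : ((crep x + crep y : ℤ) : ZMod q) = x + y := by push_cast; rw [crep_cast, crep_cast]
  calc d0 (x + y) ≤ (crep x + crep y).natAbs := d0_le_natAbs_of_intCast_eq h
    _ ≤ (crep x).natAbs + (crep y).natAbs := Int.natAbs_add_le _ _
    _ = d0 x + d0 y := by rw [natAbs_crep, natAbs_crep]

/-- `d0 (−t) = d0 t`. [folklore] -/
theorem d0_neg (t : ZMod q) : d0 (-t) = d0 t := by
  apply le_antisymm
  · have h : ((-crep t : ℤ) : ZMod q) = -t := by push_cast; rw [crep_cast]
    calc d0 (-t) ≤ (-crep t).natAbs := d0_le_natAbs_of_intCast_eq h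
      _ = d0 t := by rw [Int.natAbs_neg, natAbs_crep]
  · have h : ((-crep (-t) : ℤ) : ZMod q) = t := by push_cast; rw [crep_cast, neg_neg]
    calc d0 t ≤ (-crep (-t)).natAbs := d0_le_natAbs_of_intCast_eq h
      _ = d0 (-t) := by rw [Int.natAbs_neg, natAbs_crep]

/-- `d0 (x − y) ≤ d0 x + d0 y`. [folklore] -/
theorem d0_sub_le (x y : ZMod q) : d0 (x - y) ≤ d0 x + d0 y := by
  rw [sub_eq_add_neg]
  exact (d0_add_le x (-y)).trans (by rw [d0_neg])

/-! ### `∑_{t ≠ 0, d0 t < N} (t, q) ≤ 2 d(q) N` -/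

/-- **Counting with gcd weights**: `∑_{t ≠ 0, d0 t < N} (t, q) ≤ 2 d(q) N`. [folklore] -/
theorem sum_gcd_filter_d0_lt_le (N : ℕ) :
    ∑ t ∈ (Finset.univ : Finset (ZMod q)).filter (fun t => t ≠ 0 ∧ d0 t < N), (Nat.gcd t.val q : ℝ) ≤
      2 * ((Nat.divisors q).card * N) := by
  classical
  have hq0 : q ≠ 0 := NeZero.ne q
  set A := (Finset.univ : Finset (ZMod q)).filter (fun t => t ≠ 0 ∧ d0 t < N) with hA
  set A₁ := A.filter (fun t : ZMod q => t.val ≤ q - t.val) with hA₁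
  set A₂ := A.filter (fun t : ZMod q => ¬ t.val ≤ q - t.val) with hA₂
  have hsplit : ∑ t ∈ A, (Nat.gcd t.val q : ℝ) = ∑ t ∈ A₁, (Nat.gcd t.val q : ℝ) + ∑ t ∈ A₂, (Nat.gcd t.val q : ℝ) :=
    (Finset.sum_filter_add_sum_filter_not A (fun t : ZMod q => t.val ≤ q - t.val) _).symm
  have hbound : ∀ (B : Finset (ZMod q)) (g : ZMod q → ℕ), (∀ t ∈ B, 1 ≤ g t ∧ g t ≤ N) →
      Set.InjOn g B → (∀ t ∈ B, Nat.gcd t.val q = Nat.gcd (g t) q) →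
      ∑ t ∈ B, (Nat.gcd t.val q : ℝ) ≤ (Nat.divisors q).card * N := by
    intro B g hg hinj hgcd
    calc ∑ t ∈ B, (Nat.gcd t.val q : ℝ) = ∑ t ∈ B, (Nat.gcd (g t) q : ℝ) :=
          Finset.sum_congr rfl fun t ht => by rw [hgcd t ht]
      _ = ∑ m ∈ B.image g, (Nat.gcd m q : ℝ) :=
          (Finset.sum_image (f := fun m : ℕ => (Nat.gcd m q : ℝ)) fun x hx y hy h => hinj hx hy h).symm
      _ ≤ ∑ m ∈ Finset.Icc 1 N, (Nat.gcd m q : ℝ) := by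
          refine Finset.sum_le_sum_of_subset_of_nonneg ?_ (fun _ _ _ => Nat.cast_nonneg _)
          intro m hm
          rw [Finset.mem_image] at hm
          obtain ⟨t, ht, rfl⟩ := hm
          exact Finset.mem_Icc.mpr (hg t ht)
      _ ≤ (Nat.divisors q).card * N := sum_gcd_le_card_divisors_mul hq0 N
  rw [hsplit, two_mul]
  refine add_le_add ?_ ?_
  · refine hbound A₁ (fun t => t.val) ?_ ?_ ?_
    · intro t ht
      rw [hA₁, Finset.mem_filter, hA, Finset.mem_filter] at ht
      obtain ⟨⟨_, ht0, hd⟩, hle⟩ := ht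
      have hd0 : d0 t = t.val := by unfold d0; rw [min_eq_left hle]
      refine ⟨?_, ?_⟩
      · exact Nat.pos_of_ne_zero fun h => ht0 ((ZMod.val_eq_zero t).mp h)
      · rw [← hd0]; exact hd.le
    · intro a _ b _ h; exact ZMod.val_injective q h
    · intro t _; rfl
  · refine hbound A₂ (fun t => q - t.val) ?_ ?_ ?_
    · intro t ht
      rw [hA₂, Finset.mem_filter, hA, Finset.mem_filter] at ht
      obtain ⟨⟨_, _, hd⟩, hle⟩ := ht
      have hv : t.val < q := ZMod.val_lt t
      have hd0 : d0 t = q - t.val := by unfold d0; rw [min_eq_right (by omega)]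
      refine ⟨by omega, ?_⟩
      rw [← hd0]; exact hd.le
    · intro a ha b hb h
      have hva : a.val < q := ZMod.val_lt a
      have hvb : b.val < q := ZMod.val_lt b
      have h' : q - a.val = q - b.val := h
      apply ZMod.val_injective q
      omega
    · intro t _
      have hv : t.val < q := ZMod.val_lt t
      show Nat.gcd t.val q = Nat.gcd (q - t.val) q
      rw [Nat.gcd_self_sub_left hv.le]

/-! ### The decomposition `r = ± ρ(r) r'(r)` of a nonzero residue -/

/-- The sign of the centred representative. [folklore] -/
def csgn (r : ZMod q) : ℤ := if r.val ≤ q - r.val then 1 else -1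

/-- `crep r = csgn r · d0 r`. [folklore] -/
theorem crep_eq_csgn_mul_d0 (r : ZMod q) : crep r = csgn r * (d0 r : ℤ) := by
  have hv : r.val < q := ZMod.val_lt r
  unfold crep csgn d0
  split_ifs with h
  · rw [min_eq_left h, one_mul]
  · rw [min_eq_right (by omega), Nat.cast_sub hv.le]; ring

/-- The `q`-part `ρ(r) = ρ(d0 r)` and the coprime part `r'(r) = d0 r / ρ(r)` of a residue. [cite: HeathBrown1986d3, §4 p.41] -/
def rho (r : ZMod q) : ℕ := qpart q (d0 r)

/-- The coprime part `r' = d0 r / ρ(r)`. [cite: HeathBrown1986d3, §4 p.41] -/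
def rcop (r : ZMod q) : ℕ := d0 r / qpart q (d0 r)

omit [NeZero q] in
/-- `ρ(r) r'(r) = d0 r`. [folklore] -/
theorem rho_mul_rcop (r : ZMod q) : rho r * rcop r = d0 r := by
  unfold rho rcop; exact Nat.mul_div_cancel' (qpart_dvd q (d0 r))

/-- `(r'(r), q) = 1`. [folklore] -/
theorem rcop_coprime {r : ZMod q} (hr : r ≠ 0) : Nat.Coprime (rcop r) q := by
  unfold rcop; exact coprime_div_qpart (NeZero.ne q) (d0_pos hr).ne'

/-- `r'(r) ≥ 1`. [folklore] -/
theorem rcop_pos {r : ZMod q} (hr : r ≠ 0) : 0 < rcop r := by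
  have h := rho_mul_rcop r
  rcases Nat.eq_zero_or_pos (rcop r) with h0 | h0
  · rw [h0, mul_zero] at h; exact absurd h.symm (d0_pos hr).ne'
  · exact h0

/-- `ρ(r) ≥ 1`. [folklore] -/
theorem rho_pos {r : ZMod q} (hr : r ≠ 0) : 0 < rho r := by
  unfold rho; exact Nat.pos_of_ne_zero (qpart_ne_zero q (d0_pos hr).ne')

/-- `r'(r)` is a unit modulo `q`. [folklore] -/
theorem isUnit_rcop {r : ZMod q} (hr : r ≠ 0) : IsUnit ((rcop r : ℕ) : ZMod q) :=
  (ZMod.isUnit_iff_coprime _ _).mpr (rcop_coprime hr)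

/-- **`r = (csgn r · ρ(r)) · r'(r)` in `ℤ/qℤ`.** [cite: HeathBrown1986d3, §4 p.41] -/
theorem eq_srho_mul_rcop (r : ZMod q) : r = ((csgn r * (rho r : ℤ) : ℤ) : ZMod q) * ((rcop r : ℕ) : ZMod q) := by
  conv_lhs => rw [← crep_cast r, crep_eq_csgn_mul_d0, ← rho_mul_rcop]
  push_cast
  ring

/-- **Step 2 of Lemma 5**: `K₂(r, s, c) = K₂(±ρ(r), ±σ(s), r's'c)` for nonzero `r, s`.
[cite: HeathBrown1986d3, §4 p.41] -/
theorem K2_eq_K2_srho {r s : ZMod q} (hr : r ≠ 0) (hs : s ≠ 0) (c : ZMod q) :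
    K2 q r s c = K2 q ((csgn r * (rho r : ℤ) : ℤ) : ZMod q) ((csgn s * (rho s : ℤ) : ℤ) : ZMod q)
      (((rcop r : ℕ) : ZMod q) * ((rcop s : ℕ) : ZMod q) * c) := by
  conv_lhs => rw [eq_srho_mul_rcop r, eq_srho_mul_rcop s]
  exact K2_scale_units (isUnit_rcop hr) (isUnit_rcop hs) _ _ c

/-! ### Opening the square: `∑_h |∑_t c_t K(h,t)|² = ∑_{t₁,t₂} c_{t₁} conj c_{t₂} ∑_h K(h,t₁) conj K(h,t₂)` -/

omit [NeZero q] in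
/-- **Opening `|·|²` and swapping**: for finite sets `S, B` and `c : β → ℂ`, `K : α → β → ℂ`,
`∑_{h ∈ S} ‖∑_{t ∈ B} c t K h t‖² = ∑_{t₁ ∈ B} ∑_{t₂ ∈ B} c t₁ conj(c t₂) ∑_{h ∈ S} K h t₁ conj(K h t₂)` (as a
complex identity). [folklore] -/
theorem sum_norm_sq_sum_eq {α β : Type*} (S : Finset α) (B : Finset β) (c : β → ℂ) (K : α → β → ℂ) :
    (∑ h ∈ S, (‖∑ t ∈ B, c t * K h t‖ ^ 2 : ℝ) : ℂ) =
      ∑ t₁ ∈ B, ∑ t₂ ∈ B, c t₁ * starRingEnd ℂ (c t₂) * ∑ h ∈ S, K h t₁ * starRingEnd ℂ (K h t₂) := by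
  have hsq : ∀ h ∈ S, ((‖∑ t ∈ B, c t * K h t‖ ^ 2 : ℝ) : ℂ) =
      (∑ t ∈ B, c t * K h t) * starRingEnd ℂ (∑ t ∈ B, c t * K h t) := by
    intro h _
    rw [Complex.mul_conj, Complex.normSq_eq_norm_sq, Complex.ofReal_pow]
  rw [Finset.sum_congr rfl hsq]
  simp_rw [map_sum, map_mul, Finset.sum_mul_sum]
  rw [Finset.sum_comm]
  refine Finset.sum_congr rfl fun t₁ _ => ?_
  rw [Finset.sum_comm, ]
  refine Finset.sum_congr rfl fun t₂ _ => ?_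
  rw [Finset.mul_sum]
  refine Finset.sum_congr rfl fun h _ => ?_
  ring

omit [NeZero q] in
/-- Hence `∑_{h ∈ S} ‖∑_{t ∈ B} c t K h t‖² ≤ C² ∑_{t₁,t₂ ∈ B} ‖∑_{h ∈ S} K h t₁ conj(K h t₂)‖` when `‖c t‖ ≤ C`.
[folklore] -/
theorem sum_norm_sq_sum_le {α β : Type*} (S : Finset α) (B : Finset β) (c : β → ℂ) (K : α → β → ℂ)
    {C : ℝ} (hC : 0 ≤ C) (hc : ∀ t ∈ B, ‖c t‖ ≤ C) :
    ∑ h ∈ S, ‖∑ t ∈ B, c t * K h t‖ ^ 2 ≤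
      C ^ 2 * ∑ t₁ ∈ B, ∑ t₂ ∈ B, ‖∑ h ∈ S, K h t₁ * starRingEnd ℂ (K h t₂)‖ := by
  have e := sum_norm_sq_sum_eq S B c K
  have : ∑ h ∈ S, ‖∑ t ∈ B, c t * K h t‖ ^ 2 =
      ‖(∑ h ∈ S, (‖∑ t ∈ B, c t * K h t‖ ^ 2 : ℝ) : ℂ)‖ := by
    rw [← Complex.ofReal_sum, Complex.norm_real, Real.norm_eq_abs,
      abs_of_nonneg (Finset.sum_nonneg fun _ _ => by positivity)]
  rw [this, e]
  refine (norm_sum_le _ _).trans ?_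
  rw [Finset.mul_sum]
  refine Finset.sum_le_sum fun t₁ ht₁ => ?_
  refine (norm_sum_le _ _).trans ?_
  rw [Finset.mul_sum]
  refine Finset.sum_le_sum fun t₂ ht₂ => ?_
  rw [norm_mul, norm_mul, Complex.norm_conj]
  calc ‖c t₁‖ * ‖c t₂‖ * ‖∑ h ∈ S, K h t₁ * starRingEnd ℂ (K h t₂)‖
      ≤ C * C * ‖∑ h ∈ S, K h t₁ * starRingEnd ℂ (K h t₂)‖ :=
        mul_le_mul_of_nonneg_right (mul_le_mul (hc t₁ ht₁) (hc t₂ ht₂) (norm_nonneg _) hC) (norm_nonneg _)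
    _ = _ := by ring

/-! ### Counting over a block: `∑_{t₁ ≠ t₂ ∈ blk} √((t₁,q)(t₂,q)) (t₁ − t₂, q) ≤ 32 d(q)² T²` -/

/-- `((−u).val, q) = (u.val, q)`. [folklore] -/
theorem gcd_val_neg (u : ZMod q) : Nat.gcd (-u).val q = Nat.gcd u.val q := by
  rw [gcd_val_eq_gcd_d0, gcd_val_eq_gcd_d0, d0_neg]

/-- The inner count: for `t₁` with `d0 t₁ < 2T`, `∑_{t₂ ∈ blk_k, t₂ ≠ t₁} (t₁ − t₂, q) ≤ 8 d(q) T`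
(`T = 2^k`). [cite: HeathBrown1986d3, §4 p.43] -/
theorem sum_gcd_sub_le {k : ℕ} {t₁ : ZMod q} (ht₁ : d0 t₁ < 2 ^ (k + 1)) :
    ∑ t₂ ∈ (blk q k).filter (fun t₂ => t₂ ≠ t₁), (Nat.gcd (t₁ - t₂).val q : ℝ) ≤
      8 * ((Nat.divisors q).card * 2 ^ k) := by
  classical
  have hinj : Set.InjOn (fun t₂ : ZMod q => t₁ - t₂) ((blk q k).filter (fun t₂ => t₂ ≠ t₁)) :=
    fun a _ b _ h => by simpa using h
  calc ∑ t₂ ∈ (blk q k).filter (fun t₂ => t₂ ≠ t₁), (Nat.gcd (t₁ - t₂).val q : ℝ)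
      = ∑ u ∈ ((blk q k).filter (fun t₂ => t₂ ≠ t₁)).image (fun t₂ => t₁ - t₂), (Nat.gcd u.val q : ℝ) :=
        (Finset.sum_image (f := fun u : ZMod q => (Nat.gcd u.val q : ℝ)) fun x hx y hy h => hinj hx hy h).symm
    _ ≤ ∑ u ∈ (Finset.univ : Finset (ZMod q)).filter (fun u => u ≠ 0 ∧ d0 u < 2 ^ (k + 2)), (Nat.gcd u.val q : ℝ) := by
        refine Finset.sum_le_sum_of_subset_of_nonneg ?_ (fun _ _ _ => Nat.cast_nonneg _)
        intro u hu
        rw [Finset.mem_image] at hu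
        obtain ⟨t₂, ht₂, rfl⟩ := hu
        rw [Finset.mem_filter] at ht₂
        obtain ⟨hb, hne⟩ := ht₂
        obtain ⟨_, _, hd2⟩ := mem_blk.mp hb
        rw [Finset.mem_filter]
        refine ⟨Finset.mem_univ _, sub_ne_zero.mpr (Ne.symm hne), ?_⟩
        calc d0 (t₁ - t₂) ≤ d0 t₁ + d0 t₂ := d0_sub_le t₁ t₂
          _ < 2 ^ (k + 1) + 2 ^ (k + 1) := add_lt_add ht₁ hd2
          _ = 2 ^ (k + 2) := by ring
    _ ≤ 2 * ((Nat.divisors q).card * 2 ^ (k + 2)) := by exact_mod_cast sum_gcd_filter_d0_lt_le (q := q) (2 ^ (k + 2))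
    _ = 8 * ((Nat.divisors q).card * 2 ^ k) := by ring

/-- The outer count: `∑_{t ∈ blk_k} (t, q) ≤ 4 d(q) T`. [cite: HeathBrown1986d3, §4 p.43] -/
theorem sum_gcd_blk_le (k : ℕ) :
    ∑ t ∈ blk q k, (Nat.gcd t.val q : ℝ) ≤ 4 * ((Nat.divisors q).card * 2 ^ k) := by
  classical
  calc ∑ t ∈ blk q k, (Nat.gcd t.val q : ℝ)
      ≤ ∑ u ∈ (Finset.univ : Finset (ZMod q)).filter (fun u => u ≠ 0 ∧ d0 u < 2 ^ (k + 1)), (Nat.gcd u.val q : ℝ) := by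
        refine Finset.sum_le_sum_of_subset_of_nonneg ?_ (fun _ _ _ => Nat.cast_nonneg _)
        intro t ht
        obtain ⟨h0, _, hd⟩ := mem_blk.mp ht
        exact Finset.mem_filter.mpr ⟨Finset.mem_univ _, h0, hd⟩
    _ ≤ 2 * ((Nat.divisors q).card * 2 ^ (k + 1)) := by exact_mod_cast sum_gcd_filter_d0_lt_le (q := q) (2 ^ (k + 1))
    _ = 4 * ((Nat.divisors q).card * 2 ^ k) := by ring

omit [NeZero q] in
/-- `√(xy) ≤ (x + y)/2`. [folklore] -/
theorem sqrt_mul_le_add_half {x y : ℝ} (hx : 0 ≤ x) (hy : 0 ≤ y) : Real.sqrt (x * y) ≤ (x + y) / 2 := by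
  rw [show x * y = Real.sqrt x ^ 2 * Real.sqrt y ^ 2 by rw [Real.sq_sqrt hx, Real.sq_sqrt hy],
    show Real.sqrt x ^ 2 * Real.sqrt y ^ 2 = (Real.sqrt x * Real.sqrt y) ^ 2 by ring,
    Real.sqrt_sq (by positivity)]
  nlinarith [sq_nonneg (Real.sqrt x - Real.sqrt y), Real.sq_sqrt hx, Real.sq_sqrt hy]

/-- **The off-diagonal count on a block**:
`∑_{t₁ ≠ t₂ ∈ blk_k} √((t₁,q)(t₂,q)) (t₁ − t₂, q) ≤ 32 d(q)² T²`. [cite: HeathBrown1986d3, §4 p.43] -/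
theorem sum_offdiag_weight_le (k : ℕ) :
    ∑ t₁ ∈ blk q k, ∑ t₂ ∈ (blk q k).filter (fun t₂ => t₂ ≠ t₁),
      Real.sqrt ((Nat.gcd t₁.val q : ℝ) * (Nat.gcd t₂.val q : ℝ)) * (Nat.gcd (t₁ - t₂).val q : ℝ) ≤
      32 * ((Nat.divisors q).card * 2 ^ k) ^ 2 := by
  classical
  set B := blk q k with hB
  set d : ZMod q → ℝ := fun t => (Nat.gcd t.val q : ℝ) with hd
  set δ : ZMod q → ZMod q → ℝ := fun t₁ t₂ => (Nat.gcd (t₁ - t₂).val q : ℝ) with hδ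
  have hδsymm : ∀ t₁ t₂, δ t₁ t₂ = δ t₂ t₁ := fun t₁ t₂ => by
    simp only [hδ]; rw [← neg_sub, gcd_val_neg]
  -- `√(d₁ d₂) δ ≤ (d₁ δ + d₂ δ)/2`
  have h1 : ∑ t₁ ∈ B, ∑ t₂ ∈ B.filter (fun t₂ => t₂ ≠ t₁), Real.sqrt (d t₁ * d t₂) * δ t₁ t₂ ≤
      ∑ t₁ ∈ B, ∑ t₂ ∈ B.filter (fun t₂ => t₂ ≠ t₁), (d t₁ * δ t₁ t₂ + d t₂ * δ t₁ t₂) / 2 := by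
    refine Finset.sum_le_sum fun t₁ _ => Finset.sum_le_sum fun t₂ _ => ?_
    have := sqrt_mul_le_add_half (Nat.cast_nonneg (Nat.gcd t₁.val q)) (Nat.cast_nonneg (Nat.gcd t₂.val q))
    have hδ0 : 0 ≤ δ t₁ t₂ := Nat.cast_nonneg _
    calc Real.sqrt (d t₁ * d t₂) * δ t₁ t₂ ≤ (d t₁ + d t₂) / 2 * δ t₁ t₂ := mul_le_mul_of_nonneg_right this hδ0
      _ = _ := by ring
  -- the two halves are equal by symmetry
  have h2 : ∑ t₁ ∈ B, ∑ t₂ ∈ B.filter (fun t₂ => t₂ ≠ t₁), d t₂ * δ t₁ t₂ =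
      ∑ t₁ ∈ B, ∑ t₂ ∈ B.filter (fun t₂ => t₂ ≠ t₁), d t₁ * δ t₁ t₂ := by
    simp_rw [Finset.sum_filter]
    rw [Finset.sum_comm]
    refine Finset.sum_congr rfl fun t₁ _ => Finset.sum_congr rfl fun t₂ _ => ?_
    by_cases h : t₁ = t₂
    · subst h; simp
    · rw [if_pos h, if_pos (Ne.symm h), hδsymm]
  have h3 : ∑ t₁ ∈ B, ∑ t₂ ∈ B.filter (fun t₂ => t₂ ≠ t₁), d t₁ * δ t₁ t₂ ≤ 32 * ((Nat.divisors q).card * 2 ^ k) ^ 2 := by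
    calc ∑ t₁ ∈ B, ∑ t₂ ∈ B.filter (fun t₂ => t₂ ≠ t₁), d t₁ * δ t₁ t₂
        = ∑ t₁ ∈ B, d t₁ * ∑ t₂ ∈ B.filter (fun t₂ => t₂ ≠ t₁), δ t₁ t₂ := by
          refine Finset.sum_congr rfl fun t₁ _ => by rw [Finset.mul_sum]
      _ ≤ ∑ t₁ ∈ B, d t₁ * (8 * ((Nat.divisors q).card * 2 ^ k)) := by
          refine Finset.sum_le_sum fun t₁ ht₁ => ?_
          refine mul_le_mul_of_nonneg_left ?_ (Nat.cast_nonneg _)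
          exact sum_gcd_sub_le (mem_blk.mp ht₁).2.2
      _ = (∑ t₁ ∈ B, d t₁) * (8 * ((Nat.divisors q).card * 2 ^ k)) := by rw [Finset.sum_mul]
      _ ≤ (4 * ((Nat.divisors q).card * 2 ^ k)) * (8 * ((Nat.divisors q).card * 2 ^ k)) :=
          mul_le_mul_of_nonneg_right (sum_gcd_blk_le k) (by positivity)
      _ = 32 * ((Nat.divisors q).card * 2 ^ k) ^ 2 := by ring
  refine h1.trans ?_
  have e5 : ∑ t₁ ∈ B, ∑ t₂ ∈ B.filter (fun t₂ => t₂ ≠ t₁), (d t₁ * δ t₁ t₂ + d t₂ * δ t₁ t₂) / 2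
      = (∑ t₁ ∈ B, ∑ t₂ ∈ B.filter (fun t₂ => t₂ ≠ t₁), d t₁ * δ t₁ t₂
        + ∑ t₁ ∈ B, ∑ t₂ ∈ B.filter (fun t₂ => t₂ ≠ t₁), d t₂ * δ t₁ t₂) / 2 := by
    rw [← Finset.sum_add_distrib, Finset.sum_div]
    refine Finset.sum_congr rfl fun t₁ _ => ?_
    rw [← Finset.sum_add_distrib, Finset.sum_div]
  rw [e5, h2]
  linarith

/-- **Step 6–7 of Lemma 5 on a block**: if `‖Φ(t₁,t₂)‖ ≤ A' √((t₁,q)(t₂,q)) (t₁−t₂,q)` off the diagonal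
and `‖Φ(t,t)‖ ≤ D` on it, then `∑_{t₁,t₂ ∈ blk_k} ‖Φ(t₁,t₂)‖ ≤ 32 A' (d(q)T)² + 4T·D` (`T = 2^k`).
[cite: HeathBrown1986d3, §4 p.43] -/
theorem sum_blk_pairs_norm_le {k : ℕ} (Φ : ZMod q → ZMod q → ℂ) {A' D : ℝ} (hA : 0 ≤ A') (hD : 0 ≤ D)
    (hoff : ∀ t₁ t₂ : ZMod q, t₁ ≠ t₂ → ‖Φ t₁ t₂‖ ≤
      A' * (Real.sqrt ((Nat.gcd t₁.val q : ℝ) * (Nat.gcd t₂.val q : ℝ)) * (Nat.gcd (t₁ - t₂).val q : ℝ)))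
    (hdiag : ∀ t : ZMod q, ‖Φ t t‖ ≤ D) :
    ∑ t₁ ∈ blk q k, ∑ t₂ ∈ blk q k, ‖Φ t₁ t₂‖ ≤
      32 * A' * ((Nat.divisors q).card * 2 ^ k) ^ 2 + 4 * 2 ^ k * D := by
  classical
  set B := blk q k with hB
  have hsplit : ∀ t₁ ∈ B, ∑ t₂ ∈ B, ‖Φ t₁ t₂‖ =
      ‖Φ t₁ t₁‖ + ∑ t₂ ∈ B.filter (fun t₂ => t₂ ≠ t₁), ‖Φ t₁ t₂‖ := by
    intro t₁ ht₁
    rw [Finset.filter_ne', Finset.add_sum_erase B (fun t₂ => ‖Φ t₁ t₂‖) ht₁]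
  rw [Finset.sum_congr rfl hsplit, Finset.sum_add_distrib]
  have hcard : (B.card : ℝ) ≤ 2 ^ (k + 2) := by exact_mod_cast card_blk_le (s := q) k
  have h1 : ∑ t₁ ∈ B, ‖Φ t₁ t₁‖ ≤ 4 * 2 ^ k * D := by
    calc ∑ t₁ ∈ B, ‖Φ t₁ t₁‖ ≤ ∑ _t₁ ∈ B, D := Finset.sum_le_sum fun t _ => hdiag t
      _ = B.card * D := by rw [Finset.sum_const, nsmul_eq_mul]
      _ ≤ 2 ^ (k + 2) * D := mul_le_mul_of_nonneg_right hcard hD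
      _ = 4 * 2 ^ k * D := by ring
  have h2 : ∑ t₁ ∈ B, ∑ t₂ ∈ B.filter (fun t₂ => t₂ ≠ t₁), ‖Φ t₁ t₂‖ ≤
      32 * A' * ((Nat.divisors q).card * 2 ^ k) ^ 2 := by
    calc ∑ t₁ ∈ B, ∑ t₂ ∈ B.filter (fun t₂ => t₂ ≠ t₁), ‖Φ t₁ t₂‖
        ≤ ∑ t₁ ∈ B, ∑ t₂ ∈ B.filter (fun t₂ => t₂ ≠ t₁),
            A' * (Real.sqrt ((Nat.gcd t₁.val q : ℝ) * (Nat.gcd t₂.val q : ℝ)) * (Nat.gcd (t₁ - t₂).val q : ℝ)) := by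
          refine Finset.sum_le_sum fun t₁ _ => Finset.sum_le_sum fun t₂ ht₂ => ?_
          exact hoff t₁ t₂ (Ne.symm (Finset.mem_filter.mp ht₂).2)
      _ = A' * ∑ t₁ ∈ B, ∑ t₂ ∈ B.filter (fun t₂ => t₂ ≠ t₁),
            Real.sqrt ((Nat.gcd t₁.val q : ℝ) * (Nat.gcd t₂.val q : ℝ)) * (Nat.gcd (t₁ - t₂).val q : ℝ) := by
          rw [Finset.mul_sum]
          refine Finset.sum_congr rfl fun t₁ _ => by rw [Finset.mul_sum]
      _ ≤ A' * (32 * ((Nat.divisors q).card * 2 ^ k) ^ 2) :=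
          mul_le_mul_of_nonneg_left (sum_offdiag_weight_le k) hA
      _ = 32 * A' * ((Nat.divisors q).card * 2 ^ k) ^ 2 := by ring
  linarith

/-! ### Step 3–4: regrouping the `(r, s)`-sum by `(±ρ, ±σ, h = r's')` -/

/-- The signed `q`-part `±ρ(r)`. [cite: HeathBrown1986d3, §4 p.41] -/
def srho (r : ZMod q) : ℤ := csgn r * (rho r : ℤ)

omit [NeZero q] in
/-- `|±ρ(r)| = ρ(r)`. [folklore] -/
theorem natAbs_srho (r : ZMod q) : (srho r).natAbs = rho r := by
  unfold srho csgn
  split_ifs <;> simp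

/-- `r = (±ρ(r)) · r'(r)`. [folklore] -/
theorem eq_srho_cast_mul_rcop (r : ZMod q) : r = ((srho r : ℤ) : ZMod q) * ((rcop r : ℕ) : ZMod q) :=
  eq_srho_mul_rcop r

/-- **Counting `r` in a block with given `±ρ(r)`**: at most `2^{i+1}/|ρ̃|` of them (`r ↦ r'(r)` is
injective into `[1, 2^{i+1}/|ρ̃|]`). [cite: HeathBrown1986d3, §4 p.42] -/
theorem card_blk_filter_srho_le (i : ℕ) (ρt : ℤ) :
    ((blk q i).filter (fun r => srho r = ρt)).card ≤ 2 ^ (i + 1) / ρt.natAbs := by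
  classical
  calc ((blk q i).filter (fun r => srho r = ρt)).card
      ≤ (Finset.Icc 1 (2 ^ (i + 1) / ρt.natAbs)).card := by
        refine Finset.card_le_card_of_injOn rcop ?_ ?_
        · intro r hr
          rw [Finset.mem_coe, Finset.mem_filter] at hr
          obtain ⟨hb, hρ⟩ := hr
          obtain ⟨h0, _, hd⟩ := mem_blk.mp hb
          rw [Finset.mem_coe, Finset.mem_Icc]
          refine ⟨rcop_pos h0, ?_⟩
          rw [← hρ, natAbs_srho]
          refine (Nat.div_le_div_right (c := rho r) hd.le).trans' ?_
          rw [Nat.le_div_iff_mul_le (rho_pos h0), mul_comm, rho_mul_rcop]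
        · intro r₁ hr₁ r₂ hr₂ h
          rw [Finset.mem_coe, Finset.mem_filter] at hr₁ hr₂
          rw [eq_srho_cast_mul_rcop r₁, eq_srho_cast_mul_rcop r₂, hr₁.2, hr₂.2, h]
    _ = 2 ^ (i + 1) / ρt.natAbs := by rw [Nat.card_Icc, Nat.add_sub_cancel]

/-- **Multiplicity regrouping**: on the fibre `{(r,s) ∈ blk_i × blk_j : ±ρ(r) = ρ̃, ±σ(s) = σ̃}` the map
`(r,s) ↦ h = r's'` has multiplicity `≤ d(h) ≤ maxd`, and `h` runs over units in `[1, H₂)`,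
`H₂ = (2^{i+1}/|ρ̃|)(2^{j+1}/|σ̃|) + 1`; hence for `g ≥ 0`,
`∑_{fibre} g(r's') ≤ maxd · ∑_{h ∈ [1,H₂), (h,q)=1} g(h)`. [cite: HeathBrown1986d3, §4 p.42] -/
theorem sum_fiber_le_maxd_mul (i j : ℕ) (ρt σt : ℤ) (g : ℕ → ℝ) (hg : ∀ h, 0 ≤ g h) {maxd : ℝ}
    (hmaxd : ∀ h, h < 2 ^ (i + 1) / ρt.natAbs * (2 ^ (j + 1) / σt.natAbs) + 1 → ((Nat.divisors h).card : ℝ) ≤ maxd) :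
    ∑ p ∈ (blk q i ×ˢ blk q j).filter (fun p => srho p.1 = ρt ∧ srho p.2 = σt), g (rcop p.1 * rcop p.2) ≤
      maxd * ∑ h ∈ (Finset.Ico 1 (2 ^ (i + 1) / ρt.natAbs * (2 ^ (j + 1) / σt.natAbs) + 1)).filter
        (fun h : ℕ => IsUnit ((h : ℕ) : ZMod q)), g h := by
  classical
  set Fb := (blk q i ×ˢ blk q j).filter (fun p => srho p.1 = ρt ∧ srho p.2 = σt) with hFb
  set H₂ := 2 ^ (i + 1) / ρt.natAbs * (2 ^ (j + 1) / σt.natAbs) + 1 with hH₂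
  set key : ZMod q × ZMod q → ℕ := fun p => rcop p.1 * rcop p.2 with hkey
  have hmaxd0 : 0 ≤ maxd := (Nat.cast_nonneg _).trans (hmaxd 0 (Nat.succ_pos _))
  -- where the keys land
  have hrange : ∀ p ∈ Fb, key p ∈ (Finset.Ico 1 H₂).filter (fun h : ℕ => IsUnit ((h : ℕ) : ZMod q)) := by
    intro p hp
    rw [hFb, Finset.mem_filter, Finset.mem_product] at hp
    obtain ⟨⟨hr, hs⟩, hρ, hσ⟩ := hp
    obtain ⟨hr0, _, hrd⟩ := mem_blk.mp hr
    obtain ⟨hs0, _, hsd⟩ := mem_blk.mp hs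
    rw [Finset.mem_filter, Finset.mem_Ico]
    refine ⟨⟨Nat.mul_pos (rcop_pos hr0) (rcop_pos hs0), Nat.lt_succ_of_le ?_⟩, ?_⟩
    · refine Nat.mul_le_mul ?_ ?_
      · rw [← hρ, natAbs_srho]
        refine (Nat.div_le_div_right (c := rho p.1) hrd.le).trans' ?_
        rw [Nat.le_div_iff_mul_le (rho_pos hr0), mul_comm, rho_mul_rcop]
      · rw [← hσ, natAbs_srho]
        refine (Nat.div_le_div_right (c := rho p.2) hsd.le).trans' ?_
        rw [Nat.le_div_iff_mul_le (rho_pos hs0), mul_comm, rho_mul_rcop]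
    · simp only [hkey, Nat.cast_mul]
      exact (isUnit_rcop hr0).mul (isUnit_rcop hs0)
  -- multiplicities
  have hmult : ∀ h ∈ Fb.image key, ((Fb.filter (fun p => key p = h)).card : ℝ) ≤ maxd := by
    intro h hh
    rw [Finset.mem_image] at hh
    obtain ⟨p₀, hp₀, rfl⟩ := hh
    have hlt : key p₀ < H₂ := (Finset.mem_Ico.mp (Finset.mem_filter.mp (hrange p₀ hp₀)).1).2
    refine le_trans ?_ (hmaxd _ hlt)
    have hne : key p₀ ≠ 0 := by
      have := (Finset.mem_Ico.mp (Finset.mem_filter.mp (hrange p₀ hp₀)).1).1; omega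
    exact_mod_cast Finset.card_le_card_of_injOn (fun p : ZMod q × ZMod q => rcop p.1) (fun p hp => by
        rw [Finset.mem_coe, Finset.mem_filter] at hp
        rw [Finset.mem_coe, Nat.mem_divisors]
        exact ⟨Dvd.intro _ hp.2, hne⟩)
      (fun p₁ hp₁ p₂ hp₂ h => by
        rw [Finset.mem_coe, Finset.mem_filter, hFb, Finset.mem_filter] at hp₁ hp₂
        have h1 : rcop p₁.1 = rcop p₂.1 := h
        have hk : key p₁ = key p₂ := hp₁.2.trans hp₂.2.symm
        have hpos : 0 < rcop p₁.1 := rcop_pos (mem_blk.mp (Finset.mem_product.mp hp₁.1.1).1).1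
        have h2 : rcop p₁.2 = rcop p₂.2 := by
          simp only [hkey, h1] at hk
          exact Nat.eq_of_mul_eq_mul_left (h1 ▸ hpos) hk
        refine Prod.ext ?_ ?_
        · rw [eq_srho_cast_mul_rcop p₁.1, eq_srho_cast_mul_rcop p₂.1, hp₁.1.2.1, hp₂.1.2.1, h1]
        · rw [eq_srho_cast_mul_rcop p₁.2, eq_srho_cast_mul_rcop p₂.2, hp₁.1.2.2, hp₂.1.2.2, h2])
  calc ∑ p ∈ Fb, g (key p) = ∑ h ∈ Fb.image key, (Fb.filter (fun p => key p = h)).card • g h :=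
        Finset.sum_comp g key
    _ ≤ ∑ h ∈ Fb.image key, maxd * g h := by
        refine Finset.sum_le_sum fun h hh => ?_
        rw [nsmul_eq_mul]
        exact mul_le_mul_of_nonneg_right (hmult h hh) (hg h)
    _ = maxd * ∑ h ∈ Fb.image key, g h := by rw [Finset.mul_sum]
    _ ≤ maxd * ∑ h ∈ (Finset.Ico 1 H₂).filter (fun h : ℕ => IsUnit ((h : ℕ) : ZMod q)), g h := by
        refine mul_le_mul_of_nonneg_left ?_ hmaxd0
        refine Finset.sum_le_sum_of_subset_of_nonneg ?_ (fun h _ _ => hg h)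
        intro h hh
        rw [Finset.mem_image] at hh
        obtain ⟨p, hp, rfl⟩ := hh
        exact hrange p hp

/-! ### Step 5: Cauchy–Schwarz on a fibre -/

/-- The fibre is contained in the product of the two one-dimensional fibres. [folklore] -/
theorem card_fiber_le (i j : ℕ) (ρt σt : ℤ) :
    (((blk q i ×ˢ blk q j).filter (fun p => srho p.1 = ρt ∧ srho p.2 = σt)).card : ℝ) ≤
      (2 ^ (i + 1) / ρt.natAbs : ℕ) * (2 ^ (j + 1) / σt.natAbs : ℕ) := by
  classical
  have hsub : (blk q i ×ˢ blk q j).filter (fun p => srho p.1 = ρt ∧ srho p.2 = σt) ⊆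
      (blk q i).filter (fun r => srho r = ρt) ×ˢ (blk q j).filter (fun s => srho s = σt) := by
    intro p hp
    rw [Finset.mem_filter, Finset.mem_product] at hp
    rw [Finset.mem_product, Finset.mem_filter, Finset.mem_filter]
    exact ⟨⟨hp.1.1, hp.2.1⟩, ⟨hp.1.2, hp.2.2⟩⟩
  calc (((blk q i ×ˢ blk q j).filter (fun p => srho p.1 = ρt ∧ srho p.2 = σt)).card : ℝ)
      ≤ (((blk q i).filter (fun r => srho r = ρt) ×ˢ (blk q j).filter (fun s => srho s = σt)).card : ℝ) := by
        exact_mod_cast Finset.card_le_card hsub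
    _ = ((blk q i).filter (fun r => srho r = ρt)).card * ((blk q j).filter (fun s => srho s = σt)).card := by
        rw [Finset.card_product, Nat.cast_mul]
    _ ≤ (2 ^ (i + 1) / ρt.natAbs : ℕ) * (2 ^ (j + 1) / σt.natAbs : ℕ) := by
        gcongr
        · exact card_blk_filter_srho_le i ρt
        · exact card_blk_filter_srho_le j σt

/-- **Steps 3–5 on one fibre.** With `Ã(h) = ∑_{t ∈ blk_k} F₃(t) K₂(ρ̃, σ̃, a h t)`, `‖F₃‖ ≤ F_T` on the
block, `d(h) ≤ maxd` below `H₂`, one has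
`∑_{(r,s) ∈ fibre} ‖Ã(r's')‖ ≤ √(#fibre) · √(maxd · F_T² · ∑_{t₁,t₂ ∈ blk_k} ‖∑_{h < H₂, (h,q)=1} K₂(..ht₁) conj K₂(..ht₂)‖)`.
[cite: HeathBrown1986d3, §4 p.42, (4.4)–(4.6)] -/
theorem fiber_sum_le (i j k : ℕ) (ρt σt : ℤ) (a : ZMod q) (F₃ : ZMod q → ℂ) {FT maxd : ℝ} (hFT : 0 ≤ FT)
    (hF₃ : ∀ t ∈ blk q k, ‖F₃ t‖ ≤ FT)
    (hmaxd : ∀ h, h < 2 ^ (i + 1) / ρt.natAbs * (2 ^ (j + 1) / σt.natAbs) + 1 → ((Nat.divisors h).card : ℝ) ≤ maxd) :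
    ∑ p ∈ (blk q i ×ˢ blk q j).filter (fun p => srho p.1 = ρt ∧ srho p.2 = σt),
        ‖∑ t ∈ blk q k, F₃ t * K2 q (ρt : ZMod q) (σt : ZMod q) (a * ((rcop p.1 * rcop p.2 : ℕ) : ZMod q) * t)‖ ≤
      Real.sqrt ((2 ^ (i + 1) / ρt.natAbs : ℕ) * (2 ^ (j + 1) / σt.natAbs : ℕ)) *
        Real.sqrt (maxd * (FT ^ 2 * ∑ t₁ ∈ blk q k, ∑ t₂ ∈ blk q k,
          ‖∑ h ∈ (Finset.Ico 1 (2 ^ (i + 1) / ρt.natAbs * (2 ^ (j + 1) / σt.natAbs) + 1)).filter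
              (fun h : ℕ => IsUnit ((h : ℕ) : ZMod q)),
            K2 q (ρt : ZMod q) (σt : ZMod q) (a * (h : ZMod q) * t₁) *
              starRingEnd ℂ (K2 q (ρt : ZMod q) (σt : ZMod q) (a * (h : ZMod q) * t₂))‖)) := by
  classical
  set Fb := (blk q i ×ˢ blk q j).filter (fun p => srho p.1 = ρt ∧ srho p.2 = σt) with hFb
  set H₂ := 2 ^ (i + 1) / ρt.natAbs * (2 ^ (j + 1) / σt.natAbs) + 1 with hH₂
  set At : ℕ → ℂ := fun h => ∑ t ∈ blk q k, F₃ t * K2 q (ρt : ZMod q) (σt : ZMod q) (a * (h : ZMod q) * t)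
    with hAt
  have hmaxd0 : 0 ≤ maxd := (Nat.cast_nonneg _).trans (hmaxd 0 (Nat.succ_pos _))
  -- Cauchy–Schwarz
  have hCS : (∑ p ∈ Fb, ‖At (rcop p.1 * rcop p.2)‖) ^ 2 ≤ Fb.card * ∑ p ∈ Fb, ‖At (rcop p.1 * rcop p.2)‖ ^ 2 :=
    sq_sum_le_card_mul_sum_sq
  -- regrouping by `h`
  have hreg : ∑ p ∈ Fb, ‖At (rcop p.1 * rcop p.2)‖ ^ 2 ≤
      maxd * ∑ h ∈ (Finset.Ico 1 H₂).filter (fun h : ℕ => IsUnit ((h : ℕ) : ZMod q)), ‖At h‖ ^ 2 :=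
    sum_fiber_le_maxd_mul i j ρt σt (fun h => ‖At h‖ ^ 2) (fun h => by positivity) hmaxd
  -- opening the square
  have hopen : ∑ h ∈ (Finset.Ico 1 H₂).filter (fun h : ℕ => IsUnit ((h : ℕ) : ZMod q)), ‖At h‖ ^ 2 ≤
      FT ^ 2 * ∑ t₁ ∈ blk q k, ∑ t₂ ∈ blk q k,
        ‖∑ h ∈ (Finset.Ico 1 H₂).filter (fun h : ℕ => IsUnit ((h : ℕ) : ZMod q)),
          K2 q (ρt : ZMod q) (σt : ZMod q) (a * (h : ZMod q) * t₁) *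
            starRingEnd ℂ (K2 q (ρt : ZMod q) (σt : ZMod q) (a * (h : ZMod q) * t₂))‖ :=
    sum_norm_sq_sum_le _ (blk q k) F₃ (fun (h : ℕ) (t : ZMod q) => K2 q (ρt : ZMod q) (σt : ZMod q) (a * (h : ZMod q) * t))
      hFT hF₃
  have hcard := card_fiber_le (q := q) i j ρt σt
  have hX : 0 ≤ ∑ p ∈ Fb, ‖At (rcop p.1 * rcop p.2)‖ := Finset.sum_nonneg fun _ _ => norm_nonneg _
  have key : (∑ p ∈ Fb, ‖At (rcop p.1 * rcop p.2)‖) ^ 2 ≤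
      ((2 ^ (i + 1) / ρt.natAbs : ℕ) * (2 ^ (j + 1) / σt.natAbs : ℕ) : ℝ) *
        (maxd * (FT ^ 2 * ∑ t₁ ∈ blk q k, ∑ t₂ ∈ blk q k,
          ‖∑ h ∈ (Finset.Ico 1 H₂).filter (fun h : ℕ => IsUnit ((h : ℕ) : ZMod q)),
            K2 q (ρt : ZMod q) (σt : ZMod q) (a * (h : ZMod q) * t₁) *
              starRingEnd ℂ (K2 q (ρt : ZMod q) (σt : ZMod q) (a * (h : ZMod q) * t₂))‖)) :=
    hCS.trans (mul_le_mul hcard (hreg.trans (mul_le_mul_of_nonneg_left hopen hmaxd0))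
      (Finset.sum_nonneg fun _ _ => by positivity) (by positivity))
  have := Real.sqrt_le_sqrt key
  rw [Real.sqrt_sq hX, Real.sqrt_mul (by positivity)] at this
  convert this using 3

/-! ### The per-fibre bound in closed form -/

/-- `H₂(i,j,ρ̃,σ̃) = (2^{i+1}/|ρ̃|)(2^{j+1}/|σ̃|) + 1`, the strict upper end of the `h`-range. [folklore] -/
def H2 (i j : ℕ) (ρt σt : ℤ) : ℕ := 2 ^ (i + 1) / ρt.natAbs * (2 ^ (j + 1) / σt.natAbs) + 1

/-- The `h`-range: units `h ∈ [1, H₂)`. [folklore] -/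
def Hset (q : ℕ) [NeZero q] (i j : ℕ) (ρt σt : ℤ) : Finset ℕ :=
  (Finset.Ico 1 (H2 i j ρt σt)).filter (fun h : ℕ => IsUnit ((h : ℕ) : ZMod q))

/-- `Σ(t₁,t₂) = ∑_{h ∈ S} K₂(ρ̃,σ̃,aht₁) conj K₂(ρ̃,σ̃,aht₂)` ((4.6)). [cite: HeathBrown1986d3, (4.6)] -/
noncomputable def KK (q : ℕ) [NeZero q] (a : ZMod q) (ρt σt : ℤ) (S : Finset ℕ) (t₁ t₂ : ZMod q) : ℂ :=
  ∑ h ∈ S, K2 q (ρt : ZMod q) (σt : ZMod q) (a * (h : ZMod q) * t₁) *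
    starRingEnd ℂ (K2 q (ρt : ZMod q) (σt : ZMod q) (a * (h : ZMod q) * t₂))

/-- `(ρ̃, q)(σ̃, q)` as a real number. [folklore] -/
def ug (q : ℕ) (ρt σt : ℤ) : ℝ := (Nat.gcd ρt.natAbs q : ℝ) * (Nat.gcd σt.natAbs q : ℝ)

/-- The off-diagonal weight `√((t₁,q)(t₂,q)) (t₁ − t₂, q)`. [folklore] -/
noncomputable def offW (q : ℕ) [NeZero q] (t₁ t₂ : ZMod q) : ℝ :=
  Real.sqrt ((Nat.gcd t₁.val q : ℝ) * (Nat.gcd t₂.val q : ℝ)) * (Nat.gcd (t₁ - t₂).val q : ℝ)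

omit [NeZero q] in
/-- Auxiliary (`ug_nonneg`). [folklore] -/
theorem ug_nonneg (ρt σt : ℤ) : 0 ≤ ug q ρt σt := by unfold ug; positivity

omit [NeZero q] in
/-- Auxiliary (`one_le_ug`). [folklore] -/
theorem one_le_ug (hq : q ≠ 0) (ρt σt : ℤ) : 1 ≤ ug q ρt σt := by
  unfold ug
  have h1 : (1 : ℝ) ≤ Nat.gcd ρt.natAbs q := by exact_mod_cast Nat.pos_of_ne_zero (Nat.gcd_ne_zero_right hq)
  have h2 : (1 : ℝ) ≤ Nat.gcd σt.natAbs q := by exact_mod_cast Nat.pos_of_ne_zero (Nat.gcd_ne_zero_right hq)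
  nlinarith

/-- Auxiliary (`card_Hset_le`). [folklore] -/
theorem card_Hset_le (i j : ℕ) (ρt σt : ℤ) : (Hset q i j ρt σt).card ≤ H2 i j ρt σt := by
  unfold Hset
  calc ((Finset.Ico 1 (H2 i j ρt σt)).filter (fun h : ℕ => IsUnit ((h : ℕ) : ZMod q))).card
      ≤ (Finset.Ico 1 (H2 i j ρt σt)).card := Finset.card_filter_le _ _
    _ = H2 i j ρt σt - 1 := Nat.card_Ico _ _
    _ ≤ H2 i j ρt σt := Nat.sub_le _ _

/-- **Per-fibre bound, closed form.** Under the off-diagonal hypothesis (shape of (4.7)) and the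
diagonal hypothesis (shape of (3.1)), the fibre `(ρ̃, σ̃)` of the block `(i, j, k)` contributes at most
`√(#fibre-box) · √(maxd F_T² [32 A √u (H₂ q^{-5/6} + L) (d(q)T)² + 4T H₂ M u])`.
[cite: HeathBrown1986d3, §4 pp.42–43] -/
theorem fiber_sum_le_closed (i j k : ℕ) (ρt σt : ℤ) (a : ZMod q) (F₃ : ZMod q → ℂ) {FT maxd A L M : ℝ}
    (hFT : 0 ≤ FT) (hA : 0 ≤ A) (hL : 0 ≤ L) (hM : 0 ≤ M)
    (hF₃ : ∀ t ∈ blk q k, ‖F₃ t‖ ≤ FT)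
    (hmaxd : ∀ h, h < H2 i j ρt σt → ((Nat.divisors h).card : ℝ) ≤ maxd)
    (hoff : ∀ t₁ t₂ : ZMod q, t₁ ≠ t₂ → ‖KK q a ρt σt (Hset q i j ρt σt) t₁ t₂‖ ≤
      A * Real.sqrt (ug q ρt σt) * offW q t₁ t₂ * ((H2 i j ρt σt : ℝ) * (q : ℝ) ^ (-(5 / 6 : ℝ)) + L))
    (hdiag : ∀ c : ZMod q, ‖K2 q (ρt : ZMod q) (σt : ZMod q) c‖ ^ 2 ≤ M * ug q ρt σt) :
    ∑ p ∈ (blk q i ×ˢ blk q j).filter (fun p => srho p.1 = ρt ∧ srho p.2 = σt),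
        ‖∑ t ∈ blk q k, F₃ t * K2 q (ρt : ZMod q) (σt : ZMod q) (a * ((rcop p.1 * rcop p.2 : ℕ) : ZMod q) * t)‖ ≤
      Real.sqrt ((2 ^ (i + 1) / ρt.natAbs : ℕ) * (2 ^ (j + 1) / σt.natAbs : ℕ)) *
        Real.sqrt (maxd * (FT ^ 2 *
          (32 * (A * Real.sqrt (ug q ρt σt) * ((H2 i j ρt σt : ℝ) * (q : ℝ) ^ (-(5 / 6 : ℝ)) + L)) *
              ((Nat.divisors q).card * 2 ^ k) ^ 2 +
            4 * 2 ^ k * ((H2 i j ρt σt : ℝ) * M * ug q ρt σt)))) := by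
  have hmaxd0 : 0 ≤ maxd := (Nat.cast_nonneg _).trans (hmaxd 0 (Nat.succ_pos _))
  refine (fiber_sum_le i j k ρt σt a F₃ hFT hF₃ hmaxd).trans ?_
  refine mul_le_mul_of_nonneg_left (Real.sqrt_le_sqrt (mul_le_mul_of_nonneg_left
    (mul_le_mul_of_nonneg_left ?_ (sq_nonneg _)) hmaxd0)) (Real.sqrt_nonneg _)
  -- the pair sum, via `sum_blk_pairs_norm_le`
  have hdiag' : ∀ t : ZMod q, ‖KK q a ρt σt (Hset q i j ρt σt) t t‖ ≤ (H2 i j ρt σt : ℝ) * M * ug q ρt σt := by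
    intro t
    unfold KK
    refine (norm_sum_le _ _).trans ?_
    calc ∑ h ∈ Hset q i j ρt σt, ‖K2 q (ρt : ZMod q) (σt : ZMod q) (a * (h : ZMod q) * t) *
            starRingEnd ℂ (K2 q (ρt : ZMod q) (σt : ZMod q) (a * (h : ZMod q) * t))‖
        ≤ ∑ _h ∈ Hset q i j ρt σt, M * ug q ρt σt := by
          refine Finset.sum_le_sum fun h _ => ?_
          rw [Complex.norm_mul, Complex.norm_conj, ← sq]
          exact hdiag _
      _ = (Hset q i j ρt σt).card * (M * ug q ρt σt) := by rw [Finset.sum_const, nsmul_eq_mul]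
      _ ≤ (H2 i j ρt σt : ℝ) * (M * ug q ρt σt) := by
          refine mul_le_mul_of_nonneg_right ?_ (mul_nonneg hM (ug_nonneg _ _))
          exact_mod_cast card_Hset_le (q := q) i j ρt σt
      _ = _ := by ring
  have h := sum_blk_pairs_norm_le (k := k) (KK q a ρt σt (Hset q i j ρt σt))
    (A' := A * Real.sqrt (ug q ρt σt) * ((H2 i j ρt σt : ℝ) * (q : ℝ) ^ (-(5 / 6 : ℝ)) + L))
    (D := (H2 i j ρt σt : ℝ) * M * ug q ρt σt) (by positivity)
    (mul_nonneg (mul_nonneg (Nat.cast_nonneg _) hM) (ug_nonneg _ _))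
    (fun t₁ t₂ hne => by
      have := hoff t₁ t₂ hne
      unfold offW at this
      calc _ ≤ _ := this
        _ = _ := by ring)
    hdiag'
  unfold KK Hset H2 at h
  unfold H2
  exact h

/-! ### Heath-Brown's four inequalities (p. 43), in `√`-form -/

section Analytic

omit [NeZero q]

/-- `√T F_T ≤ √(Kq)` when `0 ≤ F_T ≤ K` and `T F_T ≤ q`. [cite: HeathBrown1986d3, p.43] -/
theorem ineq_sqrtTF {T FT K q : ℝ} (hT : 0 ≤ T) (hFT : 0 ≤ FT) (hK : FT ≤ K) (h : T * FT ≤ q) :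
    Real.sqrt T * FT ≤ Real.sqrt (K * q) := by
  have h1 : (Real.sqrt T * FT) ^ 2 ≤ K * q := by
    rw [mul_pow, Real.sq_sqrt hT]
    calc T * FT ^ 2 = FT * (T * FT) := by ring
      _ ≤ K * q := mul_le_mul hK h (mul_nonneg hT hFT) ((hFT.trans hK))
  calc Real.sqrt T * FT = Real.sqrt ((Real.sqrt T * FT) ^ 2) := (Real.sqrt_sq (by positivity)).symm
    _ ≤ Real.sqrt (K * q) := Real.sqrt_le_sqrt h1

/-- `ρ = (√√ρ)⁴`. [folklore] -/
theorem sqrt_sqrt_pow_four {ρ : ℝ} (hρ : 0 ≤ ρ) : Real.sqrt (Real.sqrt ρ) ^ 4 = ρ := by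
  rw [show (4 : ℕ) = 2 * 2 by norm_num, pow_mul, Real.sq_sqrt (Real.sqrt_nonneg _), Real.sq_sqrt hρ]

/-- `n F_R (g)^{1/4} ≤ 2q/(√√ρ)³` when `nρ ≤ 2R`, `R F_R ≤ q`, `1 ≤ g ≤ ρ`. [cite: HeathBrown1986d3, p.43] -/
theorem ineq_nF_quarter {n FR g ρ R q : ℝ} (hn : 0 ≤ n) (hFR : 0 ≤ FR) (hρ : 1 ≤ ρ) (hg : g ≤ ρ)
    (hnρ : n * ρ ≤ 2 * R) (hRF : R * FR ≤ q) :
    n * FR * Real.sqrt (Real.sqrt g) ≤ 2 * q / Real.sqrt (Real.sqrt ρ) ^ 3 := by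
  have hρ4 : 0 < Real.sqrt (Real.sqrt ρ) := Real.sqrt_pos.mpr (Real.sqrt_pos.mpr (by linarith))
  have hg4 : Real.sqrt (Real.sqrt g) ≤ Real.sqrt (Real.sqrt ρ) := Real.sqrt_le_sqrt (Real.sqrt_le_sqrt hg)
  have h4 := sqrt_sqrt_pow_four (by linarith : (0:ℝ) ≤ ρ)
  rw [le_div_iff₀ (pow_pos hρ4 3)]
  calc n * FR * Real.sqrt (Real.sqrt g) * Real.sqrt (Real.sqrt ρ) ^ 3
      ≤ n * FR * Real.sqrt (Real.sqrt ρ) * Real.sqrt (Real.sqrt ρ) ^ 3 := by gcongr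
    _ = n * FR * Real.sqrt (Real.sqrt ρ) ^ 4 := by ring
    _ = (n * ρ) * FR := by rw [h4]; ring
    _ ≤ (2 * R) * FR := mul_le_mul_of_nonneg_right hnρ hFR
    _ = 2 * (R * FR) := by ring
    _ ≤ 2 * q := by linarith

/-- `n F_R g^{1/2} ≤ 2q/(√√ρ)²`. [cite: HeathBrown1986d3, p.43] -/
theorem ineq_nF_half {n FR g ρ R q : ℝ} (hn : 0 ≤ n) (hFR : 0 ≤ FR) (hρ : 1 ≤ ρ) (hg : g ≤ ρ)
    (hnρ : n * ρ ≤ 2 * R) (hRF : R * FR ≤ q) :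
    n * FR * Real.sqrt g ≤ 2 * q / Real.sqrt (Real.sqrt ρ) ^ 2 := by
  have hρ0 : (0:ℝ) ≤ ρ := by linarith
  have hρ2 : 0 < Real.sqrt ρ := Real.sqrt_pos.mpr (by linarith)
  rw [Real.sq_sqrt (Real.sqrt_nonneg _), le_div_iff₀ hρ2]
  calc n * FR * Real.sqrt g * Real.sqrt ρ ≤ n * FR * Real.sqrt ρ * Real.sqrt ρ := by
        gcongr
    _ = (n * ρ) * FR := by rw [mul_assoc, Real.mul_self_sqrt hρ0]; ring
    _ ≤ (2 * R) * FR := mul_le_mul_of_nonneg_right hnρ hFR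
    _ = 2 * (R * FR) := by ring
    _ ≤ 2 * q := by linarith

/-- `√n F_R g^{1/4} ≤ √2 √(Iq)/√√ρ` when moreover `F_R ≤ I`. [cite: HeathBrown1986d3, p.43] -/
theorem ineq_sqrtnF_quarter {n FR g ρ R q I : ℝ} (hn : 0 ≤ n) (hFR : 0 ≤ FR) (hρ : 1 ≤ ρ) (hg : g ≤ ρ)
    (hR : 0 ≤ R) (hnρ : n * ρ ≤ 2 * R) (hRF : R * FR ≤ q) (hFI : FR ≤ I) :
    Real.sqrt n * FR * Real.sqrt (Real.sqrt g) ≤ Real.sqrt 2 * Real.sqrt (I * q) / Real.sqrt (Real.sqrt ρ) := by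
  have hρ0 : (0:ℝ) ≤ ρ := by linarith
  have hρ4 : 0 < Real.sqrt (Real.sqrt ρ) := Real.sqrt_pos.mpr (Real.sqrt_pos.mpr (by linarith))
  have hg4 : Real.sqrt (Real.sqrt g) ≤ Real.sqrt (Real.sqrt ρ) := Real.sqrt_le_sqrt (Real.sqrt_le_sqrt hg)
  have hI0 : 0 ≤ I := hFR.trans hFI
  have hq0 : 0 ≤ q := (mul_nonneg hR hFR).trans hRF
  rw [le_div_iff₀ hρ4]
  -- square both sides
  have hsq : (Real.sqrt n * FR * Real.sqrt (Real.sqrt g) * Real.sqrt (Real.sqrt ρ)) ^ 2 ≤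
      (Real.sqrt 2 * Real.sqrt (I * q)) ^ 2 := by
    calc (Real.sqrt n * FR * Real.sqrt (Real.sqrt g) * Real.sqrt (Real.sqrt ρ)) ^ 2
        ≤ (Real.sqrt n * FR * Real.sqrt (Real.sqrt ρ) * Real.sqrt (Real.sqrt ρ)) ^ 2 := by
          gcongr
      _ = n * ρ * FR * FR := by
          rw [show Real.sqrt n * FR * Real.sqrt (Real.sqrt ρ) * Real.sqrt (Real.sqrt ρ) =
            Real.sqrt n * FR * (Real.sqrt (Real.sqrt ρ)) ^ 2 by ring, Real.sq_sqrt (Real.sqrt_nonneg _), mul_pow,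
            mul_pow, Real.sq_sqrt hn, Real.sq_sqrt hρ0]
          ring
      _ ≤ 2 * R * FR * FR := by gcongr
      _ = 2 * (FR * (R * FR)) := by ring
      _ ≤ 2 * (I * q) := by gcongr
      _ = (Real.sqrt 2 * Real.sqrt (I * q)) ^ 2 := by
          rw [mul_pow, Real.sq_sqrt (by norm_num), Real.sq_sqrt (mul_nonneg hI0 hq0)]
  exact (pow_le_pow_iff_left₀ (by positivity) (by positivity) two_ne_zero).mp hsq

/-- `√(a + b) ≤ √a + √b`. [folklore] -/
theorem sqrt_add_le' {a b : ℝ} (ha : 0 ≤ a) (hb : 0 ≤ b) : Real.sqrt (a + b) ≤ Real.sqrt a + Real.sqrt b := by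
  rw [Real.sqrt_le_left (by positivity)]
  nlinarith [Real.sq_sqrt ha, Real.sq_sqrt hb, Real.sqrt_nonneg a, Real.sqrt_nonneg b]

/-- `√(√(xy)) = √√x · √√y` for `x ≥ 0`. [folklore] -/
theorem sqrt_sqrt_mul {x : ℝ} (hx : 0 ≤ x) (y : ℝ) :
    Real.sqrt (Real.sqrt (x * y)) = Real.sqrt (Real.sqrt x) * Real.sqrt (Real.sqrt y) := by
  rw [Real.sqrt_mul hx, Real.sqrt_mul (Real.sqrt_nonneg _)]

/-- `1 ≤ c ≤ c³` bookkeeping: `x/(c)³ ≤ x/c` for `x ≥ 0`, `c ≥ 1`. [folklore] -/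
theorem div_cube_le_div {x c : ℝ} (hx : 0 ≤ x) (hc : 1 ≤ c) : x / c ^ 3 ≤ x / c := by
  refine div_le_div_of_nonneg_left hx (by positivity) ?_
  calc c = c * 1 * 1 := by ring
    _ ≤ c * c * c := by gcongr
    _ = c ^ 3 := by ring

/-- `x/c² ≤ x/c` for `x ≥ 0`, `c ≥ 1`. [folklore] -/
theorem div_sq_le_div {x c : ℝ} (hx : 0 ≤ x) (hc : 1 ≤ c) : x / c ^ 2 ≤ x / c :=
  div_le_div_of_nonneg_left hx (by positivity) (by nlinarith)

/-- Term (a) of the per-fibre estimate (the `H q^{-5/6}` part of (4.7)): contributes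
`32 √(Ae) d q³/(ρ^{1/4}σ^{1/4})`. [cite: HeathBrown1986d3, §4 p.43] -/
theorem fibre_termA {FR FS FT nR nS T gρ gσ A e dq q ρ4 σ4 : ℝ}
    (hFR : 0 ≤ FR) (hFS : 0 ≤ FS) (hnR : 0 ≤ nR) (hnS : 0 ≤ nS)
    (hdq : 0 ≤ dq) (hq : 0 ≤ q) (hρ4 : 1 ≤ ρ4) (hσ4 : 1 ≤ σ4)
    (iT : T * FT ≤ q) (iR3 : nR * FR * Real.sqrt (Real.sqrt gρ) ≤ 2 * q / ρ4 ^ 3)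
    (iS3 : nS * FS * Real.sqrt (Real.sqrt gσ) ≤ 2 * q / σ4 ^ 3) :
    FR * FS * Real.sqrt (nR * nS) * FT *
        (8 * Real.sqrt (A * e) * (Real.sqrt (Real.sqrt gρ) * Real.sqrt (Real.sqrt gσ)) * Real.sqrt (nR * nS) * (dq * T)) ≤
      32 * Real.sqrt (A * e) * dq * q ^ 3 / (ρ4 * σ4) := by
  have hP : Real.sqrt (nR * nS) * Real.sqrt (nR * nS) = nR * nS := Real.mul_self_sqrt (mul_nonneg hnR hnS)
  have e3 : FR * FS * Real.sqrt (nR * nS) * FT *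
        (8 * Real.sqrt (A * e) * (Real.sqrt (Real.sqrt gρ) * Real.sqrt (Real.sqrt gσ)) * Real.sqrt (nR * nS) * (dq * T)) =
      8 * Real.sqrt (A * e) * dq * ((T * FT) * ((nR * FR * Real.sqrt (Real.sqrt gρ)) * (nS * FS * Real.sqrt (Real.sqrt gσ)))) := by
    calc _ = 8 * Real.sqrt (A * e) * dq * ((T * FT) * ((Real.sqrt (nR * nS) * Real.sqrt (nR * nS)) * FR * FS *
          Real.sqrt (Real.sqrt gρ) * Real.sqrt (Real.sqrt gσ))) := by ring
      _ = _ := by rw [hP]; ring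
  have hb1 : (nR * FR * Real.sqrt (Real.sqrt gρ)) * (nS * FS * Real.sqrt (Real.sqrt gσ)) ≤
      (2 * q / ρ4 ^ 3) * (2 * q / σ4 ^ 3) :=
    mul_le_mul iR3 iS3 (by positivity) (by positivity)
  have hb : (T * FT) * ((nR * FR * Real.sqrt (Real.sqrt gρ)) * (nS * FS * Real.sqrt (Real.sqrt gσ))) ≤
      q * ((2 * q / ρ4 ^ 3) * (2 * q / σ4 ^ 3)) :=
    mul_le_mul iT hb1 (by positivity) hq
  rw [e3]
  calc 8 * Real.sqrt (A * e) * dq * ((T * FT) * ((nR * FR * Real.sqrt (Real.sqrt gρ)) * (nS * FS * Real.sqrt (Real.sqrt gσ))))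
      ≤ 8 * Real.sqrt (A * e) * dq * (q * ((2 * q / ρ4 ^ 3) * (2 * q / σ4 ^ 3))) :=
        mul_le_mul_of_nonneg_left hb (by positivity)
    _ = 32 * Real.sqrt (A * e) * dq * q ^ 3 / (ρ4 * σ4) ^ 3 := by
        have hρ0 : ρ4 ≠ 0 := by positivity
        have hσ0 : σ4 ≠ 0 := by positivity
        field_simp
        ring
    _ ≤ 32 * Real.sqrt (A * e) * dq * q ^ 3 / (ρ4 * σ4) := div_cube_le_div (by positivity) (by nlinarith)

/-- Term (b) (the `L` part of (4.7)): contributes `12 √(AL) d q² √(IJ)/(ρ^{1/4}σ^{1/4})`.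
[cite: HeathBrown1986d3, §4 p.43] -/
theorem fibre_termB {FR FS FT nR nS T gρ gσ A L dq q I J ρ4 σ4 : ℝ}
    (hFR : 0 ≤ FR) (hFS : 0 ≤ FS) (hnR : 0 ≤ nR)
    (hdq : 0 ≤ dq) (hq : 0 ≤ q) (hI : 0 ≤ I) (hJ : 0 ≤ J) (hρ4 : 1 ≤ ρ4) (hσ4 : 1 ≤ σ4)
    (iT : T * FT ≤ q) (iR1 : Real.sqrt nR * FR * Real.sqrt (Real.sqrt gρ) ≤ Real.sqrt 2 * Real.sqrt (I * q) / ρ4)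
    (iS1 : Real.sqrt nS * FS * Real.sqrt (Real.sqrt gσ) ≤ Real.sqrt 2 * Real.sqrt (J * q) / σ4) :
    FR * FS * Real.sqrt (nR * nS) * FT *
        (Real.sqrt 32 * Real.sqrt (A * L) * (Real.sqrt (Real.sqrt gρ) * Real.sqrt (Real.sqrt gσ)) * (dq * T)) ≤
      12 * Real.sqrt (A * L) * dq * q ^ 2 * Real.sqrt (I * J) / (ρ4 * σ4) := by
  have hsP : Real.sqrt (nR * nS) = Real.sqrt nR * Real.sqrt nS := Real.sqrt_mul hnR nS
  have e3 : FR * FS * Real.sqrt (nR * nS) * FT *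
        (Real.sqrt 32 * Real.sqrt (A * L) * (Real.sqrt (Real.sqrt gρ) * Real.sqrt (Real.sqrt gσ)) * (dq * T)) =
      Real.sqrt 32 * Real.sqrt (A * L) * dq * ((T * FT) * ((Real.sqrt nR * FR * Real.sqrt (Real.sqrt gρ)) *
        (Real.sqrt nS * FS * Real.sqrt (Real.sqrt gσ)))) := by
    rw [hsP]; ring
  have hb1 : (Real.sqrt nR * FR * Real.sqrt (Real.sqrt gρ)) * (Real.sqrt nS * FS * Real.sqrt (Real.sqrt gσ)) ≤
      (Real.sqrt 2 * Real.sqrt (I * q) / ρ4) * (Real.sqrt 2 * Real.sqrt (J * q) / σ4) :=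
    mul_le_mul iR1 iS1 (by positivity) (by positivity)
  have hb : (T * FT) * ((Real.sqrt nR * FR * Real.sqrt (Real.sqrt gρ)) * (Real.sqrt nS * FS * Real.sqrt (Real.sqrt gσ))) ≤
      q * ((Real.sqrt 2 * Real.sqrt (I * q) / ρ4) * (Real.sqrt 2 * Real.sqrt (J * q) / σ4)) :=
    mul_le_mul iT hb1 (by positivity) hq
  have hIJ : Real.sqrt (I * q) * Real.sqrt (J * q) = q * Real.sqrt (I * J) := by
    rw [← Real.sqrt_mul (by positivity), show I * q * (J * q) = (I * J) * (q * q) by ring,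
      Real.sqrt_mul (by positivity), Real.sqrt_mul_self hq]; ring
  have h22 : Real.sqrt 2 * Real.sqrt 2 = 2 := Real.mul_self_sqrt (by norm_num)
  have h32 : Real.sqrt 32 ≤ 6 := by rw [Real.sqrt_le_left (by norm_num)]; norm_num
  rw [e3]
  calc Real.sqrt 32 * Real.sqrt (A * L) * dq * ((T * FT) * ((Real.sqrt nR * FR * Real.sqrt (Real.sqrt gρ)) *
        (Real.sqrt nS * FS * Real.sqrt (Real.sqrt gσ))))
      ≤ Real.sqrt 32 * Real.sqrt (A * L) * dq * (q * ((Real.sqrt 2 * Real.sqrt (I * q) / ρ4) * (Real.sqrt 2 * Real.sqrt (J * q) / σ4))) :=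
        mul_le_mul_of_nonneg_left hb (by positivity)
    _ = (Real.sqrt 32 * (Real.sqrt 2 * Real.sqrt 2)) * Real.sqrt (A * L) * dq * q * (Real.sqrt (I * q) * Real.sqrt (J * q)) / (ρ4 * σ4) := by
        have hρ0 : ρ4 ≠ 0 := by positivity
        have hσ0 : σ4 ≠ 0 := by positivity
        field_simp
    _ = (Real.sqrt 32 * 2) * (Real.sqrt (A * L) * dq * q ^ 2 * Real.sqrt (I * J)) / (ρ4 * σ4) := by
        rw [hIJ, h22]; ring
    _ ≤ 12 * (Real.sqrt (A * L) * dq * q ^ 2 * Real.sqrt (I * J)) / (ρ4 * σ4) := by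
        refine div_le_div_of_nonneg_right (mul_le_mul_of_nonneg_right (by linarith) (by positivity)) (by positivity)
    _ = _ := by ring

/-- Term (c) (the diagonal `t₁ = t₂` part): contributes `12 √M √K q^{5/2}/(ρ^{1/4}σ^{1/4})`.
[cite: HeathBrown1986d3, §4 p.43] -/
theorem fibre_termC {FR FS FT nR nS T gρ gσ M K q ρ4 σ4 : ℝ}
    (hFR : 0 ≤ FR) (hFS : 0 ≤ FS) (hnR : 0 ≤ nR) (hnS : 0 ≤ nS)
    (hK : 0 ≤ K) (hq : 0 ≤ q) (hρ4 : 1 ≤ ρ4) (hσ4 : 1 ≤ σ4)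
    (iTs : Real.sqrt T * FT ≤ Real.sqrt (K * q)) (iR2 : nR * FR * Real.sqrt gρ ≤ 2 * q / ρ4 ^ 2)
    (iS2 : nS * FS * Real.sqrt gσ ≤ 2 * q / σ4 ^ 2) :
    FR * FS * Real.sqrt (nR * nS) * FT *
        (Real.sqrt 8 * Real.sqrt M * Real.sqrt T * Real.sqrt (nR * nS) * (Real.sqrt gρ * Real.sqrt gσ)) ≤
      12 * Real.sqrt M * Real.sqrt K * (q ^ 2 * Real.sqrt q) / (ρ4 * σ4) := by
  have hP : Real.sqrt (nR * nS) * Real.sqrt (nR * nS) = nR * nS := Real.mul_self_sqrt (mul_nonneg hnR hnS)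
  have e3 : FR * FS * Real.sqrt (nR * nS) * FT *
        (Real.sqrt 8 * Real.sqrt M * Real.sqrt T * Real.sqrt (nR * nS) * (Real.sqrt gρ * Real.sqrt gσ)) =
      Real.sqrt 8 * Real.sqrt M * ((Real.sqrt T * FT) * ((nR * FR * Real.sqrt gρ) * (nS * FS * Real.sqrt gσ))) := by
    calc _ = Real.sqrt 8 * Real.sqrt M * ((Real.sqrt T * FT) * ((Real.sqrt (nR * nS) * Real.sqrt (nR * nS)) * FR * FS *
          Real.sqrt gρ * Real.sqrt gσ)) := by ring
      _ = _ := by rw [hP]; ring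
  have hb1 : (nR * FR * Real.sqrt gρ) * (nS * FS * Real.sqrt gσ) ≤ (2 * q / ρ4 ^ 2) * (2 * q / σ4 ^ 2) :=
    mul_le_mul iR2 iS2 (by positivity) (by positivity)
  have hb : (Real.sqrt T * FT) * ((nR * FR * Real.sqrt gρ) * (nS * FS * Real.sqrt gσ)) ≤
      Real.sqrt (K * q) * ((2 * q / ρ4 ^ 2) * (2 * q / σ4 ^ 2)) :=
    mul_le_mul iTs hb1 (by positivity) (Real.sqrt_nonneg _)
  have hKq : Real.sqrt (K * q) = Real.sqrt K * Real.sqrt q := Real.sqrt_mul hK q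
  have h8 : Real.sqrt 8 ≤ 3 := by rw [Real.sqrt_le_left (by norm_num)]; norm_num
  rw [e3]
  calc Real.sqrt 8 * Real.sqrt M * ((Real.sqrt T * FT) * ((nR * FR * Real.sqrt gρ) * (nS * FS * Real.sqrt gσ)))
      ≤ Real.sqrt 8 * Real.sqrt M * (Real.sqrt (K * q) * ((2 * q / ρ4 ^ 2) * (2 * q / σ4 ^ 2))) :=
        mul_le_mul_of_nonneg_left hb (by positivity)
    _ = (Real.sqrt 8 * 4) * (Real.sqrt M * Real.sqrt K * (q ^ 2 * Real.sqrt q)) / (ρ4 * σ4) ^ 2 := by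
        have hρ0 : ρ4 ≠ 0 := by positivity
        have hσ0 : σ4 ≠ 0 := by positivity
        rw [hKq]; field_simp; ring
    _ ≤ 12 * (Real.sqrt M * Real.sqrt K * (q ^ 2 * Real.sqrt q)) / (ρ4 * σ4) ^ 2 := by
        refine div_le_div_of_nonneg_right (mul_le_mul_of_nonneg_right (by linarith) (by positivity)) (by positivity)
    _ ≤ 12 * (Real.sqrt M * Real.sqrt K * (q ^ 2 * Real.sqrt q)) / (ρ4 * σ4) := div_sq_le_div (by positivity) (by nlinarith)
    _ = _ := by ring

/-- **The per-fibre analytic estimate** (HB p. 43: the four inequalities applied to the closed form):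
`F_R F_S ×` (fibre bound) `≤ √maxd (32 √(Ae) d q³ + 12 √(AL) d q² √(IJ) + 12 √M √K q^{5/2}) / (ρ^{1/4} σ^{1/4})`.
[cite: HeathBrown1986d3, §4 p.43] -/
theorem fibre_analytic {q I J K A L M e maxd dq FR FS FT R S T ρ σ gρ gσ nR nS H₂ : ℝ}
    (hA : 0 ≤ A) (hL : 0 ≤ L) (hM : 0 ≤ M) (he : 0 ≤ e) (hmaxd : 0 ≤ maxd) (hdq : 0 ≤ dq)
    (hFR : 0 ≤ FR) (hFRI : FR ≤ I) (hRF : R * FR ≤ q) (hFS : 0 ≤ FS) (hFSJ : FS ≤ J) (hSF : S * FS ≤ q)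
    (hFT : 0 ≤ FT) (hFTK : FT ≤ K) (hTF : T * FT ≤ q) (hR : 0 ≤ R) (hS : 0 ≤ S) (hT : 0 ≤ T)
    (hρ : 1 ≤ ρ) (hσ : 1 ≤ σ) (hgρ : gρ ≤ ρ) (hgσ : gσ ≤ σ) (hgρ0 : 0 ≤ gρ) (hgσ0 : 0 ≤ gσ)
    (hnR : 0 ≤ nR) (hnRρ : nR * ρ ≤ 2 * R) (hnS : 0 ≤ nS) (hnSσ : nS * σ ≤ 2 * S)
    (hH0 : 0 ≤ H₂) (hH2 : H₂ ≤ 2 * (nR * nS)) :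
    FR * FS * (Real.sqrt (nR * nS) * Real.sqrt (maxd * (FT ^ 2 *
        (32 * (A * Real.sqrt (gρ * gσ) * (H₂ * e + L)) * (dq * T) ^ 2 + 4 * T * (H₂ * M * (gρ * gσ)))))) ≤
      Real.sqrt maxd * (32 * Real.sqrt (A * e) * dq * q ^ 3 + 12 * Real.sqrt (A * L) * dq * q ^ 2 * Real.sqrt (I * J) +
        12 * Real.sqrt M * Real.sqrt K * (q ^ 2 * Real.sqrt q)) / (Real.sqrt (Real.sqrt ρ) * Real.sqrt (Real.sqrt σ)) := by
  have hq : 0 ≤ q := (mul_nonneg hR hFR).trans hRF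
  have hI : 0 ≤ I := hFR.trans hFRI
  have hJ : 0 ≤ J := hFS.trans hFSJ
  have hK : 0 ≤ K := hFT.trans hFTK
  have hρ41 : 1 ≤ Real.sqrt (Real.sqrt ρ) := by
    rw [← Real.sqrt_one]; exact Real.sqrt_le_sqrt (by rw [← Real.sqrt_one]; exact Real.sqrt_le_sqrt hρ)
  have hσ41 : 1 ≤ Real.sqrt (Real.sqrt σ) := by
    rw [← Real.sqrt_one]; exact Real.sqrt_le_sqrt (by rw [← Real.sqrt_one]; exact Real.sqrt_le_sqrt hσ)
  have hu0 : 0 ≤ gρ * gσ := mul_nonneg hgρ0 hgσ0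
  have hP0 : 0 ≤ nR * nS := mul_nonneg hnR hnS
  -- the four inequalities
  have iTs := ineq_sqrtTF hT hFT hFTK hTF
  have iR3 := ineq_nF_quarter hnR hFR hρ hgρ hnRρ hRF
  have iS3 := ineq_nF_quarter hnS hFS hσ hgσ hnSσ hSF
  have iR2 := ineq_nF_half hnR hFR hρ hgρ hnRρ hRF
  have iS2 := ineq_nF_half hnS hFS hσ hgσ hnSσ hSF
  have iR1 := ineq_sqrtnF_quarter hnR hFR hρ hgρ hR hnRρ hRF hFRI
  have iS1 := ineq_sqrtnF_quarter hnS hFS hσ hgσ hS hnSσ hSF hFSJ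
  -- split the square root into three
  set X₁ := 32 * A * Real.sqrt (gρ * gσ) * H₂ * e * (dq * T) ^ 2 with hX₁
  set X₂ := 32 * A * Real.sqrt (gρ * gσ) * L * (dq * T) ^ 2 with hX₂
  set X₃ := 4 * T * H₂ * M * (gρ * gσ) with hX₃
  have hX₁0 : 0 ≤ X₁ := by positivity
  have hX₂0 : 0 ≤ X₂ := by positivity
  have hX₃0 : 0 ≤ X₃ := by positivity
  have hsplit : Real.sqrt (maxd * (FT ^ 2 *
      (32 * (A * Real.sqrt (gρ * gσ) * (H₂ * e + L)) * (dq * T) ^ 2 + 4 * T * (H₂ * M * (gρ * gσ))))) ≤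
      Real.sqrt maxd * FT * (Real.sqrt X₁ + Real.sqrt X₂ + Real.sqrt X₃) := by
    have e1 : maxd * (FT ^ 2 * (32 * (A * Real.sqrt (gρ * gσ) * (H₂ * e + L)) * (dq * T) ^ 2 +
        4 * T * (H₂ * M * (gρ * gσ)))) = maxd * (FT ^ 2 * (X₁ + X₂ + X₃)) := by
      simp only [hX₁, hX₂, hX₃]; ring
    rw [e1, Real.sqrt_mul hmaxd, Real.sqrt_mul (sq_nonneg _), Real.sqrt_sq hFT, mul_assoc]
    refine mul_le_mul_of_nonneg_left (mul_le_mul_of_nonneg_left ?_ hFT) (Real.sqrt_nonneg _)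
    exact (sqrt_add_le' (by positivity) hX₃0).trans (add_le_add (sqrt_add_le' hX₁0 hX₂0) le_rfl)
  -- bounds for the three square roots
  have hu4 : Real.sqrt (Real.sqrt (gρ * gσ)) = Real.sqrt (Real.sqrt gρ) * Real.sqrt (Real.sqrt gσ) :=
    sqrt_sqrt_mul hgρ0 gσ
  have hsu : Real.sqrt (gρ * gσ) = Real.sqrt gρ * Real.sqrt gσ := Real.sqrt_mul hgρ0 gσ
  have hX₁b : Real.sqrt X₁ ≤ 8 * Real.sqrt (A * e) * (Real.sqrt (Real.sqrt gρ) * Real.sqrt (Real.sqrt gσ)) *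
      Real.sqrt (nR * nS) * (dq * T) := by
    rw [← hu4]
    have e2 : (8 * Real.sqrt (A * e) * Real.sqrt (Real.sqrt (gρ * gσ)) * Real.sqrt (nR * nS) * (dq * T)) ^ 2 =
        64 * (A * e) * Real.sqrt (gρ * gσ) * (nR * nS) * (dq * T) ^ 2 := by
      rw [mul_pow, mul_pow, mul_pow, mul_pow, Real.sq_sqrt (mul_nonneg hA he), Real.sq_sqrt (Real.sqrt_nonneg _),
        Real.sq_sqrt hP0]; ring
    have hle : X₁ ≤ (8 * Real.sqrt (A * e) * Real.sqrt (Real.sqrt (gρ * gσ)) * Real.sqrt (nR * nS) * (dq * T)) ^ 2 := by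
      rw [e2, hX₁]
      have : 32 * A * Real.sqrt (gρ * gσ) * H₂ * e * (dq * T) ^ 2 ≤
          32 * A * Real.sqrt (gρ * gσ) * (2 * (nR * nS)) * e * (dq * T) ^ 2 := by gcongr
      linarith
    calc Real.sqrt X₁ ≤ Real.sqrt ((8 * Real.sqrt (A * e) * Real.sqrt (Real.sqrt (gρ * gσ)) * Real.sqrt (nR * nS) * (dq * T)) ^ 2) :=
          Real.sqrt_le_sqrt hle
      _ = _ := Real.sqrt_sq (by positivity)
  have hX₂b : Real.sqrt X₂ = Real.sqrt 32 * Real.sqrt (A * L) * (Real.sqrt (Real.sqrt gρ) * Real.sqrt (Real.sqrt gσ)) * (dq * T) := by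
    rw [← hu4, hX₂, show 32 * A * Real.sqrt (gρ * gσ) * L * (dq * T) ^ 2 = ((32 * (A * L)) * Real.sqrt (gρ * gσ)) * (dq * T) ^ 2 by ring,
      Real.sqrt_mul (by positivity), Real.sqrt_sq (by positivity), Real.sqrt_mul (by positivity),
      Real.sqrt_mul (by norm_num)]
  have hX₃b : Real.sqrt X₃ ≤ Real.sqrt 8 * Real.sqrt M * Real.sqrt T * Real.sqrt (nR * nS) * (Real.sqrt gρ * Real.sqrt gσ) := by
    rw [← hsu]
    have e2 : (Real.sqrt 8 * Real.sqrt M * Real.sqrt T * Real.sqrt (nR * nS) * Real.sqrt (gρ * gσ)) ^ 2 =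
        8 * M * T * (nR * nS) * (gρ * gσ) := by
      rw [mul_pow, mul_pow, mul_pow, mul_pow, Real.sq_sqrt (by norm_num), Real.sq_sqrt hM, Real.sq_sqrt hT,
        Real.sq_sqrt hP0, Real.sq_sqrt hu0]
    have hle : X₃ ≤ (Real.sqrt 8 * Real.sqrt M * Real.sqrt T * Real.sqrt (nR * nS) * Real.sqrt (gρ * gσ)) ^ 2 := by
      rw [e2, hX₃]
      have : 4 * T * H₂ * M * (gρ * gσ) ≤ 4 * T * (2 * (nR * nS)) * M * (gρ * gσ) := by gcongr
      linarith
    calc Real.sqrt X₃ ≤ Real.sqrt ((Real.sqrt 8 * Real.sqrt M * Real.sqrt T * Real.sqrt (nR * nS) * Real.sqrt (gρ * gσ)) ^ 2) :=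
          Real.sqrt_le_sqrt hle
      _ = _ := Real.sqrt_sq (by positivity)
  have T1 := fibre_termA (A := A) (e := e) hFR hFS hnR hnS hdq hq hρ41 hσ41 hTF iR3 iS3
  have T2 := fibre_termB (A := A) (L := L) hFR hFS hnR hdq hq hI hJ hρ41 hσ41 hTF iR1 iS1
  have T3 := fibre_termC (M := M) hFR hFS hnR hnS hK hq hρ41 hσ41 iTs iR2 iS2
  -- assemble
  calc FR * FS * (Real.sqrt (nR * nS) * Real.sqrt (maxd * (FT ^ 2 *
        (32 * (A * Real.sqrt (gρ * gσ) * (H₂ * e + L)) * (dq * T) ^ 2 + 4 * T * (H₂ * M * (gρ * gσ))))))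
      ≤ FR * FS * (Real.sqrt (nR * nS) * (Real.sqrt maxd * FT * (Real.sqrt X₁ + Real.sqrt X₂ + Real.sqrt X₃))) :=
        mul_le_mul_of_nonneg_left (mul_le_mul_of_nonneg_left hsplit (Real.sqrt_nonneg _)) (mul_nonneg hFR hFS)
    _ = Real.sqrt maxd * (FR * FS * Real.sqrt (nR * nS) * FT * Real.sqrt X₁ +
          FR * FS * Real.sqrt (nR * nS) * FT * Real.sqrt X₂ + FR * FS * Real.sqrt (nR * nS) * FT * Real.sqrt X₃) := by ring
    _ ≤ Real.sqrt maxd * (32 * Real.sqrt (A * e) * dq * q ^ 3 / (Real.sqrt (Real.sqrt ρ) * Real.sqrt (Real.sqrt σ)) +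
          12 * Real.sqrt (A * L) * dq * q ^ 2 * Real.sqrt (I * J) / (Real.sqrt (Real.sqrt ρ) * Real.sqrt (Real.sqrt σ)) +
          12 * Real.sqrt M * Real.sqrt K * (q ^ 2 * Real.sqrt q) / (Real.sqrt (Real.sqrt ρ) * Real.sqrt (Real.sqrt σ))) := by
        refine mul_le_mul_of_nonneg_left (add_le_add (add_le_add ?_ ?_) ?_) (Real.sqrt_nonneg _)
        · exact (mul_le_mul_of_nonneg_left hX₁b (by positivity)).trans T1
        · rw [hX₂b]; exact T2
        · exact (mul_le_mul_of_nonneg_left hX₃b (by positivity)).trans T3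
    _ = _ := by ring

end Analytic

/-! ### Glue: the fibre bound in final form -/

/-- The universal factor `W = √maxd (32 √(A q^{-5/6}) d(q) q³ + 12 √(AL) d(q) q² √(IJ) + 12 √M √K q^{5/2})`. [folklore] -/
noncomputable def Wconst (q : ℕ) (I J K A L M maxd : ℝ) : ℝ :=
  Real.sqrt maxd * (32 * Real.sqrt (A * (q : ℝ) ^ (-(5 / 6 : ℝ))) * (Nat.divisors q).card * (q : ℝ) ^ 3 +
    12 * Real.sqrt (A * L) * (Nat.divisors q).card * (q : ℝ) ^ 2 * Real.sqrt (I * J) +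
    12 * Real.sqrt M * Real.sqrt K * ((q : ℝ) ^ 2 * Real.sqrt q))

omit [NeZero q] in
/-- Auxiliary (`Wconst_nonneg`). [folklore] -/
theorem Wconst_nonneg (I J K A L M maxd : ℝ) : 0 ≤ Wconst q I J K A L M maxd := by
  unfold Wconst; positivity

/-- **The fibre `(ρ̃, σ̃)` of block `(i, j, k)` contributes at most `W/(|ρ̃|^{1/4}|σ̃|^{1/4})`** (after the
factor `F_R F_S`). [cite: HeathBrown1986d3, §4 pp.42–43] -/
theorem fibre_bound (i j k : ℕ) (hi : 2 ^ (i + 1) ≤ q) (hj : 2 ^ (j + 1) ≤ q) {ρt σt : ℤ} (hρ : ρt ≠ 0) (hσ : σt ≠ 0)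
    (a : ZMod q) (F₃ : ZMod q → ℂ) {I J K A L M maxd : ℝ} (hI : 0 ≤ I) (hJ : 0 ≤ J) (hK : 0 ≤ K)
    (hA : 0 ≤ A) (hL : 0 ≤ L) (hM : 0 ≤ M)
    (hF₃ : ∀ t, t ≠ 0 → ‖F₃ t‖ ≤ min K ((q : ℝ) / d0 t))
    (hmaxd : ∀ h : ℕ, h ≤ q ^ 2 → ((Nat.divisors h).card : ℝ) ≤ maxd)
    (hoff : ∀ t₁ t₂ : ZMod q, t₁ ≠ t₂ → ‖KK q a ρt σt (Hset q i j ρt σt) t₁ t₂‖ ≤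
      A * Real.sqrt (ug q ρt σt) * offW q t₁ t₂ * ((H2 i j ρt σt : ℝ) * (q : ℝ) ^ (-(5 / 6 : ℝ)) + L))
    (hdiag : ∀ c : ZMod q, ‖K2 q (ρt : ZMod q) (σt : ZMod q) c‖ ^ 2 ≤ M * ug q ρt σt) :
    min I ((q : ℝ) / 2 ^ i) * min J ((q : ℝ) / 2 ^ j) *
      ∑ p ∈ (blk q i ×ˢ blk q j).filter (fun p => srho p.1 = ρt ∧ srho p.2 = σt),
        ‖∑ t ∈ blk q k, F₃ t * K2 q (ρt : ZMod q) (σt : ZMod q) (a * ((rcop p.1 * rcop p.2 : ℕ) : ZMod q) * t)‖ ≤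
      Wconst q I J K A L M maxd / (Real.sqrt (Real.sqrt (ρt.natAbs : ℝ)) * Real.sqrt (Real.sqrt (σt.natAbs : ℝ))) := by
  have hq0 : (0 : ℝ) < q := by exact_mod_cast Nat.pos_of_ne_zero (NeZero.ne q)
  set FR := min I ((q : ℝ) / 2 ^ i) with hFR
  set FS := min J ((q : ℝ) / 2 ^ j) with hFS
  set FT := min K ((q : ℝ) / 2 ^ k) with hFT
  have hFR0 : 0 ≤ FR := le_min hI (by positivity)
  have hFS0 : 0 ≤ FS := le_min hJ (by positivity)
  have hFT0 : 0 ≤ FT := le_min hK (by positivity)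
  have hF₃' : ∀ t ∈ blk q k, ‖F₃ t‖ ≤ FT := by
    intro t ht
    obtain ⟨h0, hlo, _⟩ := mem_blk.mp ht
    refine (hF₃ t h0).trans (min_le_min le_rfl ?_)
    have : (2 : ℝ) ^ k ≤ d0 t := by exact_mod_cast hlo
    exact div_le_div_of_nonneg_left hq0.le (by positivity) this
  -- `H₂ ≤ q² + 1`
  have hH2q : H2 i j ρt σt ≤ q ^ 2 + 1 := by
    unfold H2
    have h1 : 2 ^ (i + 1) / ρt.natAbs ≤ 2 ^ (i + 1) := Nat.div_le_self _ _
    have h2 : 2 ^ (j + 1) / σt.natAbs ≤ 2 ^ (j + 1) := Nat.div_le_self _ _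
    nlinarith [Nat.mul_le_mul h1 h2, Nat.mul_le_mul hi hj]
  have hmaxd' : ∀ h, h < H2 i j ρt σt → ((Nat.divisors h).card : ℝ) ≤ maxd :=
    fun h hh => hmaxd h (by omega)
  have hmaxd0 : 0 ≤ maxd := (Nat.cast_nonneg _).trans (hmaxd 0 (Nat.zero_le _))
  have step1 := fiber_sum_le_closed i j k ρt σt a F₃ hFT0 hA hL hM hF₃' hmaxd' hoff hdiag
  -- the numerics
  set nR : ℝ := ((2 ^ (i + 1) / ρt.natAbs : ℕ) : ℝ) with hnR
  set nS : ℝ := ((2 ^ (j + 1) / σt.natAbs : ℕ) : ℝ) with hnS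
  have hnR0 : 0 ≤ nR := Nat.cast_nonneg _
  have hnS0 : 0 ≤ nS := Nat.cast_nonneg _
  have hρ1 : (1 : ℝ) ≤ ρt.natAbs := by exact_mod_cast Int.natAbs_pos.mpr hρ
  have hσ1 : (1 : ℝ) ≤ σt.natAbs := by exact_mod_cast Int.natAbs_pos.mpr hσ
  have hnRρ : nR * ρt.natAbs ≤ 2 * 2 ^ i := by
    rw [hnR]; exact_mod_cast (Nat.div_mul_le_self (2 ^ (i + 1)) ρt.natAbs).trans (by rw [pow_succ]; omega)
  have hnSσ : nS * σt.natAbs ≤ 2 * 2 ^ j := by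
    rw [hnS]; exact_mod_cast (Nat.div_mul_le_self (2 ^ (j + 1)) σt.natAbs).trans (by rw [pow_succ]; omega)
  have hgρ : (Nat.gcd ρt.natAbs q : ℝ) ≤ ρt.natAbs := by exact_mod_cast Nat.gcd_le_left q (Int.natAbs_pos.mpr hρ)
  have hgσ : (Nat.gcd σt.natAbs q : ℝ) ≤ σt.natAbs := by exact_mod_cast Nat.gcd_le_left q (Int.natAbs_pos.mpr hσ)
  have hRF : (2 : ℝ) ^ i * FR ≤ q := by
    calc (2 : ℝ) ^ i * FR ≤ 2 ^ i * ((q : ℝ) / 2 ^ i) := mul_le_mul_of_nonneg_left (min_le_right _ _) (by positivity)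
      _ = q := by field_simp
  have hSF : (2 : ℝ) ^ j * FS ≤ q := by
    calc (2 : ℝ) ^ j * FS ≤ 2 ^ j * ((q : ℝ) / 2 ^ j) := mul_le_mul_of_nonneg_left (min_le_right _ _) (by positivity)
      _ = q := by field_simp
  have hTF : (2 : ℝ) ^ k * FT ≤ q := by
    calc (2 : ℝ) ^ k * FT ≤ 2 ^ k * ((q : ℝ) / 2 ^ k) := mul_le_mul_of_nonneg_left (min_le_right _ _) (by positivity)
      _ = q := by field_simp
  have hW := Wconst_nonneg (q := q) I J K A L M maxd
  -- case `nR nS = 0`: the fibre box is empty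
  rcases eq_or_ne (nR * nS) 0 with hP0 | hP0
  · refine le_trans ?_ (div_nonneg hW (by positivity))
    refine (mul_le_mul_of_nonneg_left step1 (mul_nonneg hFR0 hFS0)).trans ?_
    rw [show ((2 ^ (i + 1) / ρt.natAbs : ℕ) : ℝ) * ((2 ^ (j + 1) / σt.natAbs : ℕ) : ℝ) = nR * nS by rfl, hP0,
      Real.sqrt_zero, zero_mul, mul_zero]
  have hH2 : (H2 i j ρt σt : ℝ) ≤ 2 * (nR * nS) := by
    have hP1 : 1 ≤ (2 ^ (i + 1) / ρt.natAbs) * (2 ^ (j + 1) / σt.natAbs) := by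
      rcases Nat.eq_zero_or_pos ((2 ^ (i + 1) / ρt.natAbs) * (2 ^ (j + 1) / σt.natAbs)) with h | h
      · exfalso; apply hP0; rw [hnR, hnS, ← Nat.cast_mul, h, Nat.cast_zero]
      · exact h
    rw [hnR, hnS]
    unfold H2
    push_cast
    have : (1 : ℝ) ≤ ((2 ^ (i + 1) / ρt.natAbs : ℕ) : ℝ) * ((2 ^ (j + 1) / σt.natAbs : ℕ) : ℝ) := by exact_mod_cast hP1
    linarith
  have step2 := fibre_analytic (q := (q : ℝ)) (I := I) (J := J) (K := K) (A := A) (L := L) (M := M)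
    (e := (q : ℝ) ^ (-(5 / 6 : ℝ))) (maxd := maxd) (dq := ((Nat.divisors q).card : ℝ))
    (FR := FR) (FS := FS) (FT := FT) (R := (2 : ℝ) ^ i) (S := (2 : ℝ) ^ j) (T := (2 : ℝ) ^ k)
    (ρ := (ρt.natAbs : ℝ)) (σ := (σt.natAbs : ℝ)) (gρ := (Nat.gcd ρt.natAbs q : ℝ)) (gσ := (Nat.gcd σt.natAbs q : ℝ))
    (nR := nR) (nS := nS) (H₂ := (H2 i j ρt σt : ℝ))
    hA hL hM (by positivity) hmaxd0 (Nat.cast_nonneg _) hFR0 (min_le_left _ _) hRF hFS0 (min_le_left _ _) hSF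
    hFT0 (min_le_left _ _) hTF (by positivity) (by positivity) (by positivity) hρ1 hσ1 hgρ hgσ (Nat.cast_nonneg _)
    (Nat.cast_nonneg _) hnR0 hnRρ hnS0 hnSσ (Nat.cast_nonneg _) hH2
  have step3 := (mul_le_mul_of_nonneg_left step1 (mul_nonneg hFR0 hFS0)).trans step2
  unfold Wconst
  exact step3

/-! ### Summing `|ρ̃|^{-1/4}` over the possible signed `q`-parts -/

/-- `x^{-1/4} = 1/√√x` for `x ≥ 0`... in the direction we need: `1/√√n = n^{-(1/4))}`. [folklore] -/
theorem inv_sqrt_sqrt_eq_rpow {x : ℝ} (hx : 0 < x) : 1 / Real.sqrt (Real.sqrt x) = x ^ (-(1 / 4 : ℝ)) := by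
  rw [Real.sqrt_eq_rpow, Real.sqrt_eq_rpow, ← Real.rpow_mul hx.le, Real.rpow_neg hx.le, one_div]
  norm_num

omit [NeZero q] in
/-- `(1 − p^{−1/4})⁻¹ ≤ 8` for `p ≥ 2`. [folklore] -/
theorem inv_one_sub_rpow_le_eight {p : ℝ} (hp : 2 ≤ p) : (1 - p ^ (-(1 / 4 : ℝ)))⁻¹ ≤ 8 := by
  have hp0 : 0 < p := by linarith
  -- `p^{-1/4} ≤ 2^{-1/4} ≤ 7/8`
  have h1 : p ^ (-(1 / 4 : ℝ)) ≤ (2 : ℝ) ^ (-(1 / 4 : ℝ)) :=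
    Real.rpow_le_rpow_of_nonpos (by norm_num) hp (by norm_num)
  have h2 : (2 : ℝ) ^ (-(1 / 4 : ℝ)) ≤ 7 / 8 := by
    have h87 : (8 / 7 : ℝ) ≤ (2 : ℝ) ^ ((1 / 4 : ℝ)) := by
      have e : (8 / 7 : ℝ) = (((8 / 7 : ℝ) ^ 4)) ^ ((1 / 4 : ℝ)) := by
        rw [← Real.rpow_natCast, ← Real.rpow_mul (by norm_num)]; norm_num
      rw [e]
      exact Real.rpow_le_rpow (by norm_num) (by norm_num) (by norm_num)
    rw [Real.rpow_neg (by norm_num)]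
    rw [inv_le_comm₀ (Real.rpow_pos_of_pos (by norm_num) _) (by norm_num)]
    calc (7 / 8 : ℝ)⁻¹ = 8 / 7 := by norm_num
      _ ≤ _ := h87
  have h3 : (1 : ℝ) / 8 ≤ 1 - p ^ (-(1 / 4 : ℝ)) := by linarith
  calc (1 - p ^ (-(1 / 4 : ℝ)))⁻¹ ≤ ((1 : ℝ) / 8)⁻¹ := by
        rw [inv_le_inv₀ (by linarith) (by norm_num)]; exact h3
    _ = 8 := by norm_num

omit [NeZero q] in
/-- **`∑_{ρ q-smooth, ρ ≤ B} ρ^{-1/4} ≤ 8^{ω(q)}`.** [folklore; replaces HB's (4.2)] [folklore] -/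
theorem sum_smooth_quarter_le (q B : ℕ) :
    ∑ n ∈ (Finset.Icc 1 B).filter (fun n => n.primeFactors ⊆ q.primeFactors), (n : ℝ) ^ (-(1 / 4 : ℝ)) ≤
      8 ^ q.primeFactors.card := by
  refine (sum_smooth_rpow_neg_le q.primeFactors (fun p hp => Nat.prime_of_mem_primeFactors hp) (by norm_num) B).trans ?_
  rw [← Finset.prod_const]
  refine Finset.prod_le_prod (fun p hp => ?_) (fun p hp => ?_)
  · have h2 : (2 : ℝ) ≤ p := by exact_mod_cast (Nat.prime_of_mem_primeFactors hp).two_le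
    have : (p : ℝ) ^ (-(1 / 4 : ℝ)) < 1 := Real.rpow_lt_one_of_one_lt_of_neg (by linarith) (by norm_num)
    exact inv_nonneg.mpr (by linarith)
  · exact inv_one_sub_rpow_le_eight (by exact_mod_cast (Nat.prime_of_mem_primeFactors hp).two_le)

/-- The signed `q`-parts occurring in a block lie in `±{q-smooth ρ ≤ q}`. [folklore] -/
theorem srho_mem (r : ZMod q) (hr : r ≠ 0) :
    rho r ∈ (Finset.Icc 1 q).filter (fun n => n.primeFactors ⊆ q.primeFactors) := by
  rw [Finset.mem_filter, Finset.mem_Icc]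
  refine ⟨⟨rho_pos hr, ?_⟩, ?_⟩
  · calc rho r ≤ rho r * rcop r := Nat.le_mul_of_pos_right _ (rcop_pos hr)
      _ = d0 r := rho_mul_rcop r
      _ ≤ q := d0_le r
  · unfold rho; exact primeFactors_qpart_subset q (d0 r)

/-- **`∑_{ρ̃ ∈ srho(blk_i)} |ρ̃|^{-1/4} ≤ 2 · 8^{ω(q)}`.** [folklore] -/
theorem sum_image_srho_le (i : ℕ) :
    ∑ ρt ∈ (blk q i).image srho, 1 / Real.sqrt (Real.sqrt (ρt.natAbs : ℝ)) ≤ 2 * 8 ^ q.primeFactors.card := by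
  classical
  set Sm := (Finset.Icc 1 q).filter (fun n => n.primeFactors ⊆ q.primeFactors) with hSm
  have hsub : (blk q i).image srho ⊆ Sm.image (fun n : ℕ => (n : ℤ)) ∪ Sm.image (fun n : ℕ => -(n : ℤ)) := by
    intro ρt hρt
    rw [Finset.mem_image] at hρt
    obtain ⟨r, hr, rfl⟩ := hρt
    have hr0 : r ≠ 0 := (mem_blk.mp hr).1
    have hmem := srho_mem r hr0
    rw [Finset.mem_union, Finset.mem_image, Finset.mem_image]
    unfold srho csgn
    split_ifs
    · left; exact ⟨rho r, hmem, by ring⟩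
    · right; exact ⟨rho r, hmem, by ring⟩
  have hf0 : ∀ ρt : ℤ, 0 ≤ 1 / Real.sqrt (Real.sqrt (ρt.natAbs : ℝ)) := fun _ => by positivity
  have hval : ∀ n ∈ Sm, 1 / Real.sqrt (Real.sqrt (((n : ℤ)).natAbs : ℝ)) = (n : ℝ) ^ (-(1 / 4 : ℝ)) := by
    intro n hn
    rw [Int.natAbs_natCast]
    have hn1 : 1 ≤ n := (Finset.mem_Icc.mp (Finset.mem_filter.mp hn).1).1
    exact inv_sqrt_sqrt_eq_rpow (by exact_mod_cast hn1)
  have hval' : ∀ n ∈ Sm, 1 / Real.sqrt (Real.sqrt ((-(n : ℤ)).natAbs : ℝ)) = (n : ℝ) ^ (-(1 / 4 : ℝ)) := by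
    intro n hn
    rw [Int.natAbs_neg]; exact hval n hn
  have hZ := sum_smooth_quarter_le q q
  calc ∑ ρt ∈ (blk q i).image srho, 1 / Real.sqrt (Real.sqrt (ρt.natAbs : ℝ))
      ≤ ∑ ρt ∈ Sm.image (fun n : ℕ => (n : ℤ)) ∪ Sm.image (fun n : ℕ => -(n : ℤ)), 1 / Real.sqrt (Real.sqrt (ρt.natAbs : ℝ)) :=
        Finset.sum_le_sum_of_subset_of_nonneg hsub (fun ρt _ _ => hf0 ρt)
    _ ≤ ∑ ρt ∈ Sm.image (fun n : ℕ => (n : ℤ)), 1 / Real.sqrt (Real.sqrt (ρt.natAbs : ℝ)) +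
          ∑ ρt ∈ Sm.image (fun n : ℕ => -(n : ℤ)), 1 / Real.sqrt (Real.sqrt (ρt.natAbs : ℝ)) := by
        have e := Finset.sum_union_inter (s₁ := Sm.image (fun n : ℕ => (n : ℤ))) (s₂ := Sm.image (fun n : ℕ => -(n : ℤ)))
          (f := fun ρt : ℤ => 1 / Real.sqrt (Real.sqrt (ρt.natAbs : ℝ)))
        have hnn := Finset.sum_nonneg (s := Sm.image (fun n : ℕ => (n : ℤ)) ∩ Sm.image (fun n : ℕ => -(n : ℤ)))
          (f := fun ρt : ℤ => 1 / Real.sqrt (Real.sqrt (ρt.natAbs : ℝ))) (fun ρt _ => hf0 ρt)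
        linarith
    _ = ∑ n ∈ Sm, (n : ℝ) ^ (-(1 / 4 : ℝ)) + ∑ n ∈ Sm, (n : ℝ) ^ (-(1 / 4 : ℝ)) := by
        rw [Finset.sum_image (fun a _ b _ h => by exact_mod_cast h),
          Finset.sum_image (fun a _ b _ h => by exact_mod_cast neg_inj.mp h)]
        rw [Finset.sum_congr rfl hval, Finset.sum_congr rfl hval']
    _ ≤ 8 ^ q.primeFactors.card + 8 ^ q.primeFactors.card := add_le_add hZ hZ
    _ = 2 * 8 ^ q.primeFactors.card := by ring

/-! ### The block bound -/

/-- A nonempty block `blk_i` forces `2^{i+1} ≤ q`. [folklore] -/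
theorem two_pow_succ_le_of_mem_blk {i : ℕ} {r : ZMod q} (hr : r ∈ blk q i) : 2 ^ (i + 1) ≤ q := by
  obtain ⟨_, hlo, _⟩ := mem_blk.mp hr
  have := two_mul_d0_le r
  rw [pow_succ]; omega

/-- **The block `(i, j, k)` contributes at most `4 · 64^{ω(q)} · W`.** [cite: HeathBrown1986d3, §4 pp.41–43] -/
theorem block_bound (i j k : ℕ) (a : ZMod q) (F₁ F₂ F₃ : ZMod q → ℂ) {I J K A L M maxd : ℝ}
    (hI : 0 ≤ I) (hJ : 0 ≤ J) (hK : 0 ≤ K) (hA : 0 ≤ A) (hL : 0 ≤ L) (hM : 0 ≤ M)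
    (hF₁ : ∀ r, r ≠ 0 → ‖F₁ r‖ ≤ min I ((q : ℝ) / d0 r))
    (hF₂ : ∀ s, s ≠ 0 → ‖F₂ s‖ ≤ min J ((q : ℝ) / d0 s))
    (hF₃ : ∀ t, t ≠ 0 → ‖F₃ t‖ ≤ min K ((q : ℝ) / d0 t))
    (hmaxd : ∀ h : ℕ, h ≤ q ^ 2 → ((Nat.divisors h).card : ℝ) ≤ maxd)
    (hoff : ∀ (ρt σt : ℤ), ρt ≠ 0 → σt ≠ 0 → ∀ t₁ t₂ : ZMod q, t₁ ≠ t₂ →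
      ‖KK q a ρt σt (Hset q i j ρt σt) t₁ t₂‖ ≤
        A * Real.sqrt (ug q ρt σt) * offW q t₁ t₂ * ((H2 i j ρt σt : ℝ) * (q : ℝ) ^ (-(5 / 6 : ℝ)) + L))
    (hdiag : ∀ (ρt σt : ℤ) (c : ZMod q), ‖K2 q (ρt : ZMod q) (σt : ZMod q) c‖ ^ 2 ≤ M * ug q ρt σt) :
    ∑ r ∈ blk q i, ∑ s ∈ blk q j, ‖F₁ r‖ * ‖F₂ s‖ * ‖∑ t ∈ blk q k, F₃ t * K2 q r s (a * t)‖ ≤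
      4 * 64 ^ q.primeFactors.card * Wconst q I J K A L M maxd := by
  classical
  have hq0 : (0 : ℝ) < q := by exact_mod_cast Nat.pos_of_ne_zero (NeZero.ne q)
  have hW := Wconst_nonneg (q := q) I J K A L M maxd
  -- empty blocks
  rcases (blk q i).eq_empty_or_nonempty with hie | ⟨r₀, hr₀⟩
  · rw [hie, Finset.sum_empty]; positivity
  rcases (blk q j).eq_empty_or_nonempty with hje | ⟨s₀, hs₀⟩
  · simp only [hje, Finset.sum_empty, Finset.sum_const_zero]; positivity
  have hi : 2 ^ (i + 1) ≤ q := two_pow_succ_le_of_mem_blk hr₀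
  have hj : 2 ^ (j + 1) ≤ q := two_pow_succ_le_of_mem_blk hs₀
  set FR := min I ((q : ℝ) / 2 ^ i) with hFR
  set FS := min J ((q : ℝ) / 2 ^ j) with hFS
  have hFR0 : 0 ≤ FR := le_min hI (by positivity)
  have hFS0 : 0 ≤ FS := le_min hJ (by positivity)
  have hF₁' : ∀ r ∈ blk q i, ‖F₁ r‖ ≤ FR := by
    intro r hr
    obtain ⟨h0, hlo, _⟩ := mem_blk.mp hr
    refine (hF₁ r h0).trans (min_le_min le_rfl ?_)
    have : (2 : ℝ) ^ i ≤ d0 r := by exact_mod_cast hlo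
    exact div_le_div_of_nonneg_left hq0.le (by positivity) this
  have hF₂' : ∀ s ∈ blk q j, ‖F₂ s‖ ≤ FS := by
    intro s hs
    obtain ⟨h0, hlo, _⟩ := mem_blk.mp hs
    refine (hF₂ s h0).trans (min_le_min le_rfl ?_)
    have : (2 : ℝ) ^ j ≤ d0 s := by exact_mod_cast hlo
    exact div_le_div_of_nonneg_left hq0.le (by positivity) this
  set g : ZMod q × ZMod q → ℝ := fun p => ‖∑ t ∈ blk q k, F₃ t * K2 q p.1 p.2 (a * t)‖ with hg
  -- Step A: pull out `F_R F_S`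
  have hA1 : ∑ r ∈ blk q i, ∑ s ∈ blk q j, ‖F₁ r‖ * ‖F₂ s‖ * ‖∑ t ∈ blk q k, F₃ t * K2 q r s (a * t)‖ ≤
      FR * FS * ∑ p ∈ blk q i ×ˢ blk q j, g p := by
    rw [Finset.mul_sum, Finset.sum_product]
    refine Finset.sum_le_sum fun r hr => Finset.sum_le_sum fun s hs => ?_
    simp only [hg]
    have h3 : 0 ≤ ‖∑ t ∈ blk q k, F₃ t * K2 q r s (a * t)‖ := norm_nonneg _
    calc ‖F₁ r‖ * ‖F₂ s‖ * ‖∑ t ∈ blk q k, F₃ t * K2 q r s (a * t)‖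
        ≤ FR * FS * ‖∑ t ∈ blk q k, F₃ t * K2 q r s (a * t)‖ := by
          refine mul_le_mul_of_nonneg_right ?_ h3
          exact mul_le_mul (hF₁' r hr) (hF₂' s hs) (norm_nonneg _) hFR0
      _ = _ := rfl
  -- Step B: fibrewise
  set key : ZMod q × ZMod q → ℤ × ℤ := fun p => (srho p.1, srho p.2) with hkey
  set Pij := (blk q i ×ˢ blk q j).image key with hPij
  have hB : ∑ p ∈ blk q i ×ˢ blk q j, g p =
      ∑ κ ∈ Pij, ∑ p ∈ (blk q i ×ˢ blk q j).filter (fun p => key p = κ), g p :=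
    (Finset.sum_fiberwise_of_maps_to (fun p hp => Finset.mem_image_of_mem key hp) g).symm
  -- Step C: each fibre
  have hC : ∀ κ ∈ Pij, FR * FS * ∑ p ∈ (blk q i ×ˢ blk q j).filter (fun p => key p = κ), g p ≤
      Wconst q I J K A L M maxd / (Real.sqrt (Real.sqrt (κ.1.natAbs : ℝ)) * Real.sqrt (Real.sqrt (κ.2.natAbs : ℝ))) := by
    intro κ hκ
    rw [hPij, Finset.mem_image] at hκ
    obtain ⟨p₀, hp₀, hκ⟩ := hκ
    have hρ0 : κ.1 ≠ 0 := by
      rw [← hκ]; simp only [hkey]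
      unfold srho csgn
      have := rho_pos (mem_blk.mp (Finset.mem_product.mp hp₀).1).1
      split_ifs <;> simp <;> omega
    have hσ0 : κ.2 ≠ 0 := by
      rw [← hκ]; simp only [hkey]
      unfold srho csgn
      have := rho_pos (mem_blk.mp (Finset.mem_product.mp hp₀).2).1
      split_ifs <;> simp <;> omega
    have hfb := fibre_bound i j k hi hj hρ0 hσ0 a F₃ hI hJ hK hA hL hM hF₃ hmaxd (hoff κ.1 κ.2 hρ0 hσ0) (hdiag κ.1 κ.2)
    have hfilter : (blk q i ×ˢ blk q j).filter (fun p => key p = κ) =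
        (blk q i ×ˢ blk q j).filter (fun p => srho p.1 = κ.1 ∧ srho p.2 = κ.2) := by
      refine Finset.filter_congr fun p _ => ?_
      simp only [hkey, Prod.ext_iff]
    have hsum : ∑ p ∈ (blk q i ×ˢ blk q j).filter (fun p => key p = κ), g p =
        ∑ p ∈ (blk q i ×ˢ blk q j).filter (fun p => srho p.1 = κ.1 ∧ srho p.2 = κ.2),
          ‖∑ t ∈ blk q k, F₃ t * K2 q (κ.1 : ZMod q) (κ.2 : ZMod q) (a * ((rcop p.1 * rcop p.2 : ℕ) : ZMod q) * t)‖ := by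
      rw [hfilter]
      refine Finset.sum_congr rfl fun p hp => ?_
      rw [Finset.mem_filter, Finset.mem_product] at hp
      obtain ⟨⟨hr, hs⟩, h1, h2⟩ := hp
      have hinner : ∑ t ∈ blk q k, F₃ t * K2 q p.1 p.2 (a * t) =
          ∑ t ∈ blk q k, F₃ t * K2 q (κ.1 : ZMod q) (κ.2 : ZMod q) (a * ((rcop p.1 * rcop p.2 : ℕ) : ZMod q) * t) := by
        refine Finset.sum_congr rfl fun t _ => ?_
        have harg : ((rcop p.1 : ℕ) : ZMod q) * ((rcop p.2 : ℕ) : ZMod q) * (a * t) =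
            a * ((rcop p.1 * rcop p.2 : ℕ) : ZMod q) * t := by push_cast; ring
        unfold srho at h1 h2
        rw [K2_eq_K2_srho (mem_blk.mp hr).1 (mem_blk.mp hs).1, h1, h2, harg]
      simp only [hg]
      rw [hinner]
    rw [hsum]
    exact hfb
  -- Step D: sum over fibres
  have hD : ∑ κ ∈ Pij, Wconst q I J K A L M maxd / (Real.sqrt (Real.sqrt (κ.1.natAbs : ℝ)) * Real.sqrt (Real.sqrt (κ.2.natAbs : ℝ))) ≤
      Wconst q I J K A L M maxd * ((2 * 8 ^ q.primeFactors.card) * (2 * 8 ^ q.primeFactors.card)) := by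
    have hsub : Pij ⊆ (blk q i).image srho ×ˢ (blk q j).image srho := by
      intro κ hκ
      rw [hPij, Finset.mem_image] at hκ
      obtain ⟨p, hp, rfl⟩ := hκ
      rw [Finset.mem_product] at hp ⊢
      exact ⟨Finset.mem_image_of_mem _ hp.1, Finset.mem_image_of_mem _ hp.2⟩
    calc ∑ κ ∈ Pij, Wconst q I J K A L M maxd / (Real.sqrt (Real.sqrt (κ.1.natAbs : ℝ)) * Real.sqrt (Real.sqrt (κ.2.natAbs : ℝ)))
        ≤ ∑ κ ∈ (blk q i).image srho ×ˢ (blk q j).image srho,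
            Wconst q I J K A L M maxd / (Real.sqrt (Real.sqrt (κ.1.natAbs : ℝ)) * Real.sqrt (Real.sqrt (κ.2.natAbs : ℝ))) :=
          Finset.sum_le_sum_of_subset_of_nonneg hsub (fun _ _ _ => by positivity)
      _ = Wconst q I J K A L M maxd * ((∑ ρt ∈ (blk q i).image srho, 1 / Real.sqrt (Real.sqrt (ρt.natAbs : ℝ))) *
            (∑ σt ∈ (blk q j).image srho, 1 / Real.sqrt (Real.sqrt (σt.natAbs : ℝ)))) := by
          rw [Finset.sum_mul_sum, Finset.mul_sum, Finset.sum_product]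
          refine Finset.sum_congr rfl fun ρt _ => ?_
          rw [Finset.mul_sum]
          refine Finset.sum_congr rfl fun σt _ => ?_
          rw [div_eq_mul_one_div, one_div_mul_one_div]
      _ ≤ Wconst q I J K A L M maxd * ((2 * 8 ^ q.primeFactors.card) * (2 * 8 ^ q.primeFactors.card)) := by
          refine mul_le_mul_of_nonneg_left ?_ hW
          exact mul_le_mul (sum_image_srho_le i) (sum_image_srho_le j)
            (Finset.sum_nonneg fun _ _ => by positivity) (by positivity)
  -- assemble
  calc ∑ r ∈ blk q i, ∑ s ∈ blk q j, ‖F₁ r‖ * ‖F₂ s‖ * ‖∑ t ∈ blk q k, F₃ t * K2 q r s (a * t)‖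
      ≤ FR * FS * ∑ p ∈ blk q i ×ˢ blk q j, g p := hA1
    _ = ∑ κ ∈ Pij, FR * FS * ∑ p ∈ (blk q i ×ˢ blk q j).filter (fun p => key p = κ), g p := by
        rw [hB, Finset.mul_sum]
    _ ≤ ∑ κ ∈ Pij, Wconst q I J K A L M maxd / (Real.sqrt (Real.sqrt (κ.1.natAbs : ℝ)) * Real.sqrt (Real.sqrt (κ.2.natAbs : ℝ))) :=
        Finset.sum_le_sum hC
    _ ≤ Wconst q I J K A L M maxd * ((2 * 8 ^ q.primeFactors.card) * (2 * 8 ^ q.primeFactors.card)) := hD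
    _ = 4 * 64 ^ q.primeFactors.card * Wconst q I J K A L M maxd := by
        rw [show (64 : ℝ) = 8 * 8 by norm_num, mul_pow]; ring

/-! ### Dyadic decomposition of the nonzero residues and the core of Lemma 5 -/

omit [NeZero q] in
/-- **`∑_{t ≠ 0} f(t) = ∑_{k ≤ log₂ q} ∑_{t ∈ blk_k} f(t)`.** [folklore] -/
theorem sum_ne_zero_eq_sum_blk [NeZero q] {M : Type*} [AddCommMonoid M] (f : ZMod q → M) :
    ∑ t ∈ (Finset.univ : Finset (ZMod q)).filter (fun t => t ≠ 0), f t =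
      ∑ k ∈ Finset.range (Nat.log 2 q + 1), ∑ t ∈ blk q k, f t := by
  classical
  have hmaps : ∀ t ∈ (Finset.univ : Finset (ZMod q)).filter (fun t => t ≠ 0),
      Nat.log 2 (d0 t) ∈ Finset.range (Nat.log 2 q + 1) :=
    fun t _ => Finset.mem_range.mpr (Nat.lt_succ_of_le (log_d0_le t))
  rw [← Finset.sum_fiberwise_of_maps_to hmaps]
  refine Finset.sum_congr rfl fun k _ => Finset.sum_congr ?_ fun _ _ => rfl
  ext t
  simp only [Finset.mem_filter, Finset.mem_univ, true_and, mem_blk]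
  constructor
  · rintro ⟨ht0, hk⟩
    have := mem_blk.mp (mem_blk_log ht0)
    rw [hk] at this
    exact this
  · rintro hb
    exact ⟨hb.1, Nat.log_eq_of_pow_le_of_lt_pow hb.2.1 hb.2.2⟩

/-- **Core of Heath-Brown's Lemma 5 (principal estimate), residue-level form.** For a unit... (any) `a`,
functions `F₁, F₂, F₃` on `ℤ/qℤ` with `‖F₁(r)‖ ≤ min(I, q/|r|)` etc., and constants `A, L, M, maxd` such that
the `(4.7)`-type bound `hoff` (to be supplied by Lemma 4 + Lemma 1, i.e. Weil + Birch–Bombieri) and the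
`(3.1)`-type bound `hdiag` (Deligne) hold, one has
`‖∑_{r,s,t ≠ 0} K₂(r,s,at;q) F₁(r)F₂(s)F₃(t)‖ ≤ 4 (log₂ q + 1)³ 64^{ω(q)} W`,
`W = √maxd (32 √(A q^{-5/6}) d(q) q³ + 12 √(AL) d(q) q² √(IJ) + 12 √M √K q^{5/2})`.
With `A ≍ d_A(q) q^{5/2}`, `L ≍ d(q) log q`, `M ≍ (q d₃(q))²`, `maxd ≪ q^{ε}` this is
`q^{3+ε}(q^{5/6} + q^{1/4}(IJ)^{1/2} + q^{1/2}K^{1/2})`, i.e. HB's Lemma 5 (times the normalisation `q³`).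
[cite: HeathBrown1986d3, Lemma 5 and §4] -/
theorem core_lemma5 (a : ZMod q) (F₁ F₂ F₃ : ZMod q → ℂ) {I J K A L M maxd : ℝ}
    (hI : 0 ≤ I) (hJ : 0 ≤ J) (hK : 0 ≤ K) (hA : 0 ≤ A) (hL : 0 ≤ L) (hM : 0 ≤ M)
    (hF₁ : ∀ r, r ≠ 0 → ‖F₁ r‖ ≤ min I ((q : ℝ) / d0 r))
    (hF₂ : ∀ s, s ≠ 0 → ‖F₂ s‖ ≤ min J ((q : ℝ) / d0 s))
    (hF₃ : ∀ t, t ≠ 0 → ‖F₃ t‖ ≤ min K ((q : ℝ) / d0 t))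
    (hmaxd : ∀ h : ℕ, h ≤ q ^ 2 → ((Nat.divisors h).card : ℝ) ≤ maxd)
    (hoff : ∀ (i j : ℕ) (ρt σt : ℤ), ρt ≠ 0 → σt ≠ 0 → ∀ t₁ t₂ : ZMod q, t₁ ≠ t₂ →
      ‖KK q a ρt σt (Hset q i j ρt σt) t₁ t₂‖ ≤
        A * Real.sqrt (ug q ρt σt) * offW q t₁ t₂ * ((H2 i j ρt σt : ℝ) * (q : ℝ) ^ (-(5 / 6 : ℝ)) + L))
    (hdiag : ∀ (ρt σt : ℤ) (c : ZMod q), ‖K2 q (ρt : ZMod q) (σt : ZMod q) c‖ ^ 2 ≤ M * ug q ρt σt) :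
    ‖∑ r ∈ (Finset.univ : Finset (ZMod q)).filter (fun r => r ≠ 0),
        ∑ s ∈ (Finset.univ : Finset (ZMod q)).filter (fun s => s ≠ 0),
          ∑ t ∈ (Finset.univ : Finset (ZMod q)).filter (fun t => t ≠ 0),
            K2 q r s (a * t) * (F₁ r * F₂ s * F₃ t)‖ ≤
      4 * ((Nat.log 2 q + 1 : ℕ) : ℝ) ^ 3 * 64 ^ q.primeFactors.card * Wconst q I J K A L M maxd := by
  classical
  set NZ := (Finset.univ : Finset (ZMod q)).filter (fun t => t ≠ 0) with hNZ
  set Lg := Nat.log 2 q + 1 with hLg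
  have hW := Wconst_nonneg (q := q) I J K A L M maxd
  -- pull the scalars and bound by norms
  have h1 : ‖∑ r ∈ NZ, ∑ s ∈ NZ, ∑ t ∈ NZ, K2 q r s (a * t) * (F₁ r * F₂ s * F₃ t)‖ ≤
      ∑ r ∈ NZ, ∑ s ∈ NZ, ‖F₁ r‖ * ‖F₂ s‖ * ‖∑ t ∈ NZ, F₃ t * K2 q r s (a * t)‖ := by
    refine (norm_sum_le _ _).trans (Finset.sum_le_sum fun r _ => ?_)
    refine (norm_sum_le _ _).trans (Finset.sum_le_sum fun s _ => ?_)
    have e : ∑ t ∈ NZ, K2 q r s (a * t) * (F₁ r * F₂ s * F₃ t) = F₁ r * F₂ s * ∑ t ∈ NZ, F₃ t * K2 q r s (a * t) := by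
      rw [Finset.mul_sum]; exact Finset.sum_congr rfl fun t _ => by ring
    rw [e, norm_mul, norm_mul]
  -- `‖∑_{t ≠ 0}‖ ≤ ∑_k ‖∑_{t ∈ blk_k}‖`
  have h2 : ∀ r s : ZMod q, ‖∑ t ∈ NZ, F₃ t * K2 q r s (a * t)‖ ≤
      ∑ k ∈ Finset.range Lg, ‖∑ t ∈ blk q k, F₃ t * K2 q r s (a * t)‖ := by
    intro r s
    rw [hNZ, sum_ne_zero_eq_sum_blk]
    exact norm_sum_le _ _
  have h3 : ∑ r ∈ NZ, ∑ s ∈ NZ, ‖F₁ r‖ * ‖F₂ s‖ * ‖∑ t ∈ NZ, F₃ t * K2 q r s (a * t)‖ ≤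
      ∑ k ∈ Finset.range Lg, ∑ i ∈ Finset.range Lg, ∑ j ∈ Finset.range Lg,
        ∑ r ∈ blk q i, ∑ s ∈ blk q j, ‖F₁ r‖ * ‖F₂ s‖ * ‖∑ t ∈ blk q k, F₃ t * K2 q r s (a * t)‖ := by
    calc ∑ r ∈ NZ, ∑ s ∈ NZ, ‖F₁ r‖ * ‖F₂ s‖ * ‖∑ t ∈ NZ, F₃ t * K2 q r s (a * t)‖
        ≤ ∑ r ∈ NZ, ∑ s ∈ NZ, ‖F₁ r‖ * ‖F₂ s‖ * ∑ k ∈ Finset.range Lg, ‖∑ t ∈ blk q k, F₃ t * K2 q r s (a * t)‖ := by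
          refine Finset.sum_le_sum fun r _ => Finset.sum_le_sum fun s _ => ?_
          exact mul_le_mul_of_nonneg_left (h2 r s) (mul_nonneg (norm_nonneg _) (norm_nonneg _))
      _ = ∑ r ∈ NZ, ∑ s ∈ NZ, ∑ k ∈ Finset.range Lg, ‖F₁ r‖ * ‖F₂ s‖ * ‖∑ t ∈ blk q k, F₃ t * K2 q r s (a * t)‖ := by
          simp_rw [Finset.mul_sum]
      _ = ∑ r ∈ NZ, ∑ k ∈ Finset.range Lg, ∑ s ∈ NZ, ‖F₁ r‖ * ‖F₂ s‖ * ‖∑ t ∈ blk q k, F₃ t * K2 q r s (a * t)‖ :=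
          Finset.sum_congr rfl fun r _ => Finset.sum_comm
      _ = ∑ k ∈ Finset.range Lg, ∑ r ∈ NZ, ∑ s ∈ NZ, ‖F₁ r‖ * ‖F₂ s‖ * ‖∑ t ∈ blk q k, F₃ t * K2 q r s (a * t)‖ :=
          Finset.sum_comm
      _ = ∑ k ∈ Finset.range Lg, ∑ i ∈ Finset.range Lg, ∑ j ∈ Finset.range Lg,
            ∑ r ∈ blk q i, ∑ s ∈ blk q j, ‖F₁ r‖ * ‖F₂ s‖ * ‖∑ t ∈ blk q k, F₃ t * K2 q r s (a * t)‖ := by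
          refine Finset.sum_congr rfl fun k _ => ?_
          rw [hNZ, sum_ne_zero_eq_sum_blk]
          refine Finset.sum_congr rfl fun i _ => ?_
          have : ∀ r : ZMod q, ∑ s ∈ (Finset.univ : Finset (ZMod q)).filter (fun t => t ≠ 0),
              ‖F₁ r‖ * ‖F₂ s‖ * ‖∑ t ∈ blk q k, F₃ t * K2 q r s (a * t)‖ =
              ∑ j ∈ Finset.range Lg, ∑ s ∈ blk q j, ‖F₁ r‖ * ‖F₂ s‖ * ‖∑ t ∈ blk q k, F₃ t * K2 q r s (a * t)‖ :=
            fun r => sum_ne_zero_eq_sum_blk _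
          simp_rw [this]
          rw [Finset.sum_comm]
  -- each block
  have h4 : ∀ k i j : ℕ, ∑ r ∈ blk q i, ∑ s ∈ blk q j, ‖F₁ r‖ * ‖F₂ s‖ * ‖∑ t ∈ blk q k, F₃ t * K2 q r s (a * t)‖ ≤
      4 * 64 ^ q.primeFactors.card * Wconst q I J K A L M maxd :=
    fun k i j => block_bound i j k a F₁ F₂ F₃ hI hJ hK hA hL hM hF₁ hF₂ hF₃ hmaxd (hoff i j) hdiag
  calc ‖∑ r ∈ NZ, ∑ s ∈ NZ, ∑ t ∈ NZ, K2 q r s (a * t) * (F₁ r * F₂ s * F₃ t)‖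
      ≤ ∑ k ∈ Finset.range Lg, ∑ i ∈ Finset.range Lg, ∑ j ∈ Finset.range Lg,
          ∑ r ∈ blk q i, ∑ s ∈ blk q j, ‖F₁ r‖ * ‖F₂ s‖ * ‖∑ t ∈ blk q k, F₃ t * K2 q r s (a * t)‖ := h1.trans h3
    _ ≤ ∑ _k ∈ Finset.range Lg, ∑ _i ∈ Finset.range Lg, ∑ _j ∈ Finset.range Lg,
          4 * 64 ^ q.primeFactors.card * Wconst q I J K A L M maxd :=
        Finset.sum_le_sum fun k _ => Finset.sum_le_sum fun i _ => Finset.sum_le_sum fun j _ => h4 k i j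
    _ = 4 * ((Lg : ℕ) : ℝ) ^ 3 * 64 ^ q.primeFactors.card * Wconst q I J K A L M maxd := by
        simp only [Finset.sum_const, Finset.card_range, nsmul_eq_mul]; ring



/-! ### B2: `∑_{k ≤ q} (k², D)^{1/2}/k ≪ d(D) log q` -/

/-! ### gcd bookkeeping for residues -/

/-- `((z mod q).val, q) = (|z|, q)`. [folklore] -/
theorem gcd_val_intCast (z : ℤ) : Nat.gcd ((z : ZMod q)).val q = Nat.gcd z.natAbs q := by
  have h1 : ((((z : ZMod q).val : ℕ) : ℤ)).gcd (q : ℤ) = Int.gcd z q := by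
    rw [ZMod.val_intCast, Int.gcd_emod]
  have h2 : Nat.gcd (z : ZMod q).val q = Int.gcd z q := by
    rw [← h1, Int.gcd_natCast_natCast]
  rw [h2, Int.gcd_eq_natAbs, Int.natAbs_natCast]

omit [NeZero q] in
/-- `((u x).val, q) = (x.val, q)` for a unit `u`. [folklore] -/
theorem gcd_val_unit_mul {u : ZMod q} (hu : IsUnit u) (x : ZMod q) : Nat.gcd (u * x).val q = Nat.gcd x.val q := by
  apply Nat.dvd_antisymm
  · refine Nat.dvd_gcd ?_ (Nat.gcd_dvd_right _ _)
    -- `x = u⁻¹ (u x)`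
    have e : x = u⁻¹ * (u * x) := by rw [← mul_assoc, ZMod.inv_mul_of_unit u hu, one_mul]
    have hx : x.val = ((u⁻¹).val * (u * x).val) % q := by
      conv_lhs => rw [e]; exact ZMod.val_mul _ _
    rw [hx]
    have hg : Nat.gcd (u * x).val q ∣ (u⁻¹).val * (u * x).val := Dvd.dvd.mul_left (Nat.gcd_dvd_left _ _) _
    exact (Nat.dvd_mod_iff (Nat.gcd_dvd_right _ _)).mpr hg
  · refine Nat.dvd_gcd ?_ (Nat.gcd_dvd_right _ _)
    have hx : (u * x).val = (u.val * x.val) % q := ZMod.val_mul _ _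
    rw [hx]
    have hg : Nat.gcd x.val q ∣ u.val * x.val := Dvd.dvd.mul_left (Nat.gcd_dvd_left _ _) _
    exact (Nat.dvd_mod_iff (Nat.gcd_dvd_right _ _)).mpr hg

/-- `(aⁿ, q) ≤ (a, q)ⁿ` (`q ≠ 0`, `n ≥ 1`). [folklore] -/
theorem gcd_pow_le_pow_gcd (a D n : ℕ) (hD : D ≠ 0) (hn : n ≠ 0) : Nat.gcd (a ^ n) D ≤ (Nat.gcd a D) ^ n := by
  rcases Nat.eq_zero_or_pos (Nat.gcd a D) with hg | hg
  · exact absurd (Nat.eq_zero_of_gcd_eq_zero_right hg) hD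
  obtain ⟨g, a', D', hgpos, hcop, rfl, rfl⟩ := Nat.exists_coprime' (m := a) (n := D) hg
  rw [Nat.gcd_mul_right, hcop.gcd_eq_one, one_mul, mul_pow]
  obtain ⟨m, hm⟩ : ∃ m, n = m + 1 := ⟨n - 1, by omega⟩
  subst hm
  have h1 : Nat.gcd (a' ^ (m + 1) * g ^ (m + 1)) (D' * g) = g * Nat.gcd (a' ^ (m + 1) * g ^ m) D' := by
    rw [show a' ^ (m + 1) * g ^ (m + 1) = (a' ^ (m + 1) * g ^ m) * g by ring, Nat.gcd_mul_right, mul_comm]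
  rw [h1]
  have h2 : Nat.gcd (a' ^ (m + 1) * g ^ m) D' = Nat.gcd (g ^ m) D' :=
    Nat.Coprime.gcd_mul_left_cancel _ (Nat.Coprime.pow_left (m + 1) hcop)
  rw [h2, pow_succ, mul_comm (g ^ m) g]
  refine Nat.mul_le_mul_left g (Nat.le_of_dvd (pow_pos hgpos m) (Nat.gcd_dvd_left _ _))

/-! ### The abstract Lemma-4 shape and the `S`-term bounds -/

/-- The Lemma-4 bound shape (without the factor `d_A(q) q^{5/2}`, which is absorbed in `A₄`):
`√((k², Δ², q)(t₁,q)(t₂,q)(ρ,q)(σ,q)) · (Δ³, q)^{1/6}`. [cite: HeathBrown1986d3, Lemma 4] -/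
noncomputable def L4shape (q : ℕ) (k t₁ t₂ ρ σ : ℤ) : ℝ :=
  Real.sqrt ((Nat.gcd (Nat.gcd (k ^ 2).natAbs ((t₁ - t₂) ^ 2).natAbs) q : ℝ) *
      ((Nat.gcd t₁.natAbs q : ℝ) * (Nat.gcd t₂.natAbs q) * (Nat.gcd ρ.natAbs q) * (Nat.gcd σ.natAbs q))) *
    ((Nat.gcd ((t₁ - t₂) ^ 3).natAbs q : ℕ) : ℝ) ^ (1 / 6 : ℝ)

/-- **The `S(k)`-term for `k ≠ 0`**: with integer lifts, the Lemma-4 shape is at most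
`√((k²,q)) · √((t₁,q)(t₂,q)) · √((ρ,q)(σ,q)) · (t₁ − t₂, q)`. [cite: HeathBrown1986d3, §4 p.43] -/
theorem L4shape_le (z : ℤ) (t₁ t₂ : ZMod q) (ρ σ : ℤ) :
    L4shape q z (t₁.val : ℤ) (t₂.val : ℤ) ρ σ ≤
      Real.sqrt (Nat.gcd (z ^ 2).natAbs q : ℝ) *
        (Real.sqrt ((Nat.gcd t₁.val q : ℝ) * (Nat.gcd t₂.val q)) *
          Real.sqrt ((Nat.gcd ρ.natAbs q : ℝ) * (Nat.gcd σ.natAbs q)) * (Nat.gcd (t₁ - t₂).val q : ℝ)) := by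
  have hq : q ≠ 0 := NeZero.ne q
  unfold L4shape
  set Δ : ℤ := (t₁.val : ℤ) - (t₂.val : ℤ) with hΔ
  have hΔcast : ((Δ : ℤ) : ZMod q) = t₁ - t₂ := by
    rw [hΔ]; push_cast; rw [ZMod.natCast_zmod_val, ZMod.natCast_zmod_val]
  have hgΔ : Nat.gcd Δ.natAbs q = Nat.gcd (t₁ - t₂).val q := by rw [← gcd_val_intCast Δ, hΔcast]
  have hδ1 : (1 : ℝ) ≤ Nat.gcd (t₁ - t₂).val q := by
    exact_mod_cast Nat.pos_of_ne_zero (Nat.gcd_ne_zero_right hq)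
  -- `(k², Δ², q) ≤ (k², q)`
  have h1 : (Nat.gcd (Nat.gcd (z ^ 2).natAbs (Δ ^ 2).natAbs) q : ℝ) ≤ Nat.gcd (z ^ 2).natAbs q := by
    exact_mod_cast Nat.le_of_dvd (Nat.pos_of_ne_zero (Nat.gcd_ne_zero_right hq))
      (Nat.dvd_gcd ((Nat.gcd_dvd_left _ _).trans (Nat.gcd_dvd_left _ _)) (Nat.gcd_dvd_right _ _))
  -- `(Δ³, q)^{1/6} ≤ (Δ, q)^{1/2} ≤ (Δ, q)`
  have h2 : ((Nat.gcd (Δ ^ 3).natAbs q : ℕ) : ℝ) ^ (1 / 6 : ℝ) ≤ Nat.gcd (t₁ - t₂).val q := by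
    have h3 : Nat.gcd (Δ ^ 3).natAbs q ≤ (Nat.gcd Δ.natAbs q) ^ 3 := by
      rw [Int.natAbs_pow]; exact gcd_pow_le_pow_gcd _ _ 3 hq (by norm_num)
    have h3' : ((Nat.gcd (Δ ^ 3).natAbs q : ℕ) : ℝ) ≤ ((Nat.gcd (t₁ - t₂).val q : ℝ)) ^ (3 : ℕ) := by
      rw [← hgΔ]; exact_mod_cast h3
    calc ((Nat.gcd (Δ ^ 3).natAbs q : ℕ) : ℝ) ^ (1 / 6 : ℝ)
        ≤ (((Nat.gcd (t₁ - t₂).val q : ℝ)) ^ (3 : ℕ)) ^ (1 / 6 : ℝ) :=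
          Real.rpow_le_rpow (Nat.cast_nonneg _) h3' (by norm_num)
      _ = (Nat.gcd (t₁ - t₂).val q : ℝ) ^ (1 / 2 : ℝ) := by
          rw [← Real.rpow_natCast, ← Real.rpow_mul (Nat.cast_nonneg _)]; norm_num
      _ ≤ (Nat.gcd (t₁ - t₂).val q : ℝ) ^ (1 : ℝ) := Real.rpow_le_rpow_of_exponent_le hδ1 (by norm_num)
      _ = _ := Real.rpow_one _
  have ht₁ : ((t₁.val : ℤ)).natAbs = t₁.val := Int.natAbs_natCast _
  have ht₂ : ((t₂.val : ℤ)).natAbs = t₂.val := Int.natAbs_natCast _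
  rw [ht₁, ht₂]
  calc Real.sqrt ((Nat.gcd (Nat.gcd (z ^ 2).natAbs (Δ ^ 2).natAbs) q : ℝ) *
        ((Nat.gcd t₁.val q : ℝ) * (Nat.gcd t₂.val q) * (Nat.gcd ρ.natAbs q) * (Nat.gcd σ.natAbs q))) *
        ((Nat.gcd (Δ ^ 3).natAbs q : ℕ) : ℝ) ^ (1 / 6 : ℝ)
      ≤ Real.sqrt ((Nat.gcd (z ^ 2).natAbs q : ℝ) *
        ((Nat.gcd t₁.val q : ℝ) * (Nat.gcd t₂.val q) * (Nat.gcd ρ.natAbs q) * (Nat.gcd σ.natAbs q))) *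
        (Nat.gcd (t₁ - t₂).val q : ℝ) := by
        refine mul_le_mul (Real.sqrt_le_sqrt (mul_le_mul_of_nonneg_right h1 (by positivity))) h2
          (by positivity) (Real.sqrt_nonneg _)
    _ = _ := by
        rw [Real.sqrt_mul (Nat.cast_nonneg _), show (Nat.gcd t₁.val q : ℝ) * (Nat.gcd t₂.val q) * (Nat.gcd ρ.natAbs q) *
          (Nat.gcd σ.natAbs q) = ((Nat.gcd t₁.val q : ℝ) * (Nat.gcd t₂.val q)) * ((Nat.gcd ρ.natAbs q) * (Nat.gcd σ.natAbs q)) by ring,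
          Real.sqrt_mul (by positivity)]
        ring

/-- **The `S(0)`-term**: the Lemma-4 shape at `k = 0` is at most
`q^{1/6} · √((t₁,q)(t₂,q)) · √((ρ,q)(σ,q)) · (t₁ − t₂, q)` (using `(Δ²,q)^{1/2} ≤ (Δ,q)`,
`(Δ³,q)^{1/6} ≤ q^{1/6}`). [cite: HeathBrown1986d3, §4 p.43] -/
theorem L4shape_zero_le (t₁ t₂ : ZMod q) (ρ σ : ℤ) :
    L4shape q 0 (t₁.val : ℤ) (t₂.val : ℤ) ρ σ ≤
      (q : ℝ) ^ (1 / 6 : ℝ) *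
        (Real.sqrt ((Nat.gcd t₁.val q : ℝ) * (Nat.gcd t₂.val q)) *
          Real.sqrt ((Nat.gcd ρ.natAbs q : ℝ) * (Nat.gcd σ.natAbs q)) * (Nat.gcd (t₁ - t₂).val q : ℝ)) := by
  have hq : q ≠ 0 := NeZero.ne q
  unfold L4shape
  set Δ : ℤ := (t₁.val : ℤ) - (t₂.val : ℤ) with hΔ
  have hΔcast : ((Δ : ℤ) : ZMod q) = t₁ - t₂ := by
    rw [hΔ]; push_cast; rw [ZMod.natCast_zmod_val, ZMod.natCast_zmod_val]
  have hgΔ : Nat.gcd Δ.natAbs q = Nat.gcd (t₁ - t₂).val q := by rw [← gcd_val_intCast Δ, hΔcast]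
  -- `(0², Δ², q) = (Δ², q) ≤ (Δ, q)²`
  have h1 : (Nat.gcd (Nat.gcd ((0 : ℤ) ^ 2).natAbs (Δ ^ 2).natAbs) q : ℝ) ≤ (Nat.gcd (t₁ - t₂).val q : ℝ) ^ 2 := by
    rw [← hgΔ]
    simp only [ne_eq, OfNat.ofNat_ne_zero, not_false_eq_true, zero_pow, Int.natAbs_zero, Nat.gcd_zero_left,
      Int.natAbs_pow]
    exact_mod_cast gcd_sq_le_sq_gcd Δ.natAbs q hq
  -- `(Δ³, q)^{1/6} ≤ q^{1/6}`
  have h2 : ((Nat.gcd (Δ ^ 3).natAbs q : ℕ) : ℝ) ^ (1 / 6 : ℝ) ≤ (q : ℝ) ^ (1 / 6 : ℝ) := by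
    refine Real.rpow_le_rpow (Nat.cast_nonneg _) ?_ (by norm_num)
    exact_mod_cast Nat.le_of_dvd (Nat.pos_of_ne_zero hq) (Nat.gcd_dvd_right _ _)
  have ht₁ : ((t₁.val : ℤ)).natAbs = t₁.val := Int.natAbs_natCast _
  have ht₂ : ((t₂.val : ℤ)).natAbs = t₂.val := Int.natAbs_natCast _
  rw [ht₁, ht₂]
  calc Real.sqrt ((Nat.gcd (Nat.gcd ((0 : ℤ) ^ 2).natAbs (Δ ^ 2).natAbs) q : ℝ) *
        ((Nat.gcd t₁.val q : ℝ) * (Nat.gcd t₂.val q) * (Nat.gcd ρ.natAbs q) * (Nat.gcd σ.natAbs q))) *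
        ((Nat.gcd (Δ ^ 3).natAbs q : ℕ) : ℝ) ^ (1 / 6 : ℝ)
      ≤ Real.sqrt ((Nat.gcd (t₁ - t₂).val q : ℝ) ^ 2 *
        ((Nat.gcd t₁.val q : ℝ) * (Nat.gcd t₂.val q) * (Nat.gcd ρ.natAbs q) * (Nat.gcd σ.natAbs q))) *
        (q : ℝ) ^ (1 / 6 : ℝ) := by
        refine mul_le_mul (Real.sqrt_le_sqrt (mul_le_mul_of_nonneg_right h1 (by positivity))) h2
          (by positivity) (Real.sqrt_nonneg _)
    _ = _ := by
        rw [Real.sqrt_mul (sq_nonneg _), Real.sqrt_sq (Nat.cast_nonneg _),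
          show (Nat.gcd t₁.val q : ℝ) * (Nat.gcd t₂.val q) * (Nat.gcd ρ.natAbs q) *
          (Nat.gcd σ.natAbs q) = ((Nat.gcd t₁.val q : ℝ) * (Nat.gcd t₂.val q)) * ((Nat.gcd ρ.natAbs q) * (Nat.gcd σ.natAbs q)) by ring,
          Real.sqrt_mul (by positivity)]
        ring

/-! ### Geometric sums over `h ∈ (0, M]` (natural indices) -/

omit [NeZero q] in
/-- `image (ℕ → ℤ) (Ioc 0 M) = Ioc 0 M`. [folklore] -/
theorem image_natCast_Ioc_zero (M : ℕ) :
    (Finset.Ioc 0 M).image (fun h : ℕ => (h : ℤ)) = Finset.Ioc (0 : ℤ) (M : ℤ) := by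
  ext z
  rw [Finset.mem_image, Finset.mem_Ioc]
  constructor
  · rintro ⟨h, hh, rfl⟩
    rw [Finset.mem_Ioc] at hh
    exact ⟨by exact_mod_cast hh.1, by exact_mod_cast hh.2⟩
  · rintro ⟨h0, hM⟩
    refine ⟨z.toNat, Finset.mem_Ioc.mpr ⟨by omega, by omega⟩, by omega⟩

/-- **`|∑_{0 < h ≤ M} e_q(w h)| ≤ q/(2 d0 w)`** for `w ≠ 0`. [folklore] -/
theorem norm_sum_Ioc_nat_stdAddChar_le {w : ZMod q} (hw : w ≠ 0) (M : ℕ) :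
    ‖∑ h ∈ Finset.Ioc 0 M, (ZMod.stdAddChar (w * ((h : ℕ) : ZMod q)) : ℂ)‖ ≤ (q : ℝ) / (2 * d0 w) := by
  have hq0 : (0 : ℝ) < q := by exact_mod_cast Nat.pos_of_ne_zero (NeZero.ne q)
  have e : ∑ h ∈ Finset.Ioc 0 M, (ZMod.stdAddChar (w * ((h : ℕ) : ZMod q)) : ℂ) =
      ∑ z ∈ Finset.Ioc (0 : ℤ) (M : ℤ), (ZMod.stdAddChar (w * (z : ZMod q)) : ℂ) := by
    rw [← image_natCast_Ioc_zero, Finset.sum_image (fun a _ b _ h => by exact_mod_cast h)]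
    refine Finset.sum_congr rfl fun h _ => ?_
    rw [Int.cast_natCast]
  rw [e]
  refine (lemma412_norm_sum_Ioc_stdAddChar_le hw _ _).trans ?_
  have hd0 : (0 : ℝ) < d0 w := by exact_mod_cast d0_pos hw
  have hdist : (d0 w : ℝ) / q ≤ distInt (((w.val : ℕ) : ℝ) / q) := d0_div_le_distInt w
  have hpos : 0 < (d0 w : ℝ) / q := div_pos hd0 hq0
  rw [div_le_div_iff₀ (by linarith) (by positivity)]
  calc 1 * (2 * (d0 w : ℝ)) = 2 * ((d0 w : ℝ) / q) * q := by field_simp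
    _ ≤ 2 * distInt (((w.val : ℕ) : ℝ) / q) * q := by gcongr
    _ = q * (2 * distInt (((w.val : ℕ) : ℝ) / q)) := by ring

/-- Trivial bound `|∑_{0<h≤M} e_q(w h)| ≤ M`. [folklore] -/
theorem norm_sum_Ioc_nat_stdAddChar_le_card (w : ZMod q) (M : ℕ) :
    ‖∑ h ∈ Finset.Ioc 0 M, (ZMod.stdAddChar (w * ((h : ℕ) : ZMod q)) : ℂ)‖ ≤ M := by
  refine (norm_sum_le _ _).trans (le_of_eq ?_)
  calc ∑ h ∈ Finset.Ioc 0 M, ‖(ZMod.stdAddChar (w * ((h : ℕ) : ZMod q)) : ℂ)‖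
      = ∑ _h ∈ Finset.Ioc 0 M, (1 : ℝ) := Finset.sum_congr rfl fun h _ => AddChar.norm_apply _ _
    _ = M := by rw [Finset.sum_const, Nat.card_Ioc, nsmul_eq_mul, mul_one, Nat.sub_zero]

/-! ### `∑_{k ≠ 0} f(d0 k) ≤ 2 ∑_{1 ≤ m ≤ q} f(m)` -/

/-- **Folding the nonzero residues onto `[1, q]` via `d0`.** [folklore] -/
theorem sum_ne_zero_d0_le (f : ℕ → ℝ) (hf : ∀ m, 0 ≤ f m) :
    ∑ k ∈ (Finset.univ : Finset (ZMod q)).filter (fun k => k ≠ 0), f (d0 k) ≤ 2 * ∑ m ∈ Finset.Icc 1 q, f m := by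
  classical
  set A := (Finset.univ : Finset (ZMod q)).filter (fun k => k ≠ 0) with hA
  set A₁ := A.filter (fun t : ZMod q => t.val ≤ q - t.val) with hA₁
  set A₂ := A.filter (fun t : ZMod q => ¬ t.val ≤ q - t.val) with hA₂
  have hsplit : ∑ t ∈ A, f (d0 t) = ∑ t ∈ A₁, f (d0 t) + ∑ t ∈ A₂, f (d0 t) :=
    (Finset.sum_filter_add_sum_filter_not A (fun t : ZMod q => t.val ≤ q - t.val) _).symm
  have hbound : ∀ (B : Finset (ZMod q)), (∀ t ∈ B, 1 ≤ d0 t) → Set.InjOn (d0 (s := q)) (B : Set (ZMod q)) →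
      ∑ t ∈ B, f (d0 t) ≤ ∑ m ∈ Finset.Icc 1 q, f m := by
    intro B hB hinj
    calc ∑ t ∈ B, f (d0 t) = ∑ m ∈ B.image d0, f m := (Finset.sum_image fun x hx y hy h => hinj hx hy h).symm
      _ ≤ ∑ m ∈ Finset.Icc 1 q, f m := by
          refine Finset.sum_le_sum_of_subset_of_nonneg ?_ (fun m _ _ => hf m)
          intro m hm
          rw [Finset.mem_image] at hm
          obtain ⟨t, ht, rfl⟩ := hm
          exact Finset.mem_Icc.mpr ⟨hB t ht, d0_le t⟩
  rw [hsplit, two_mul]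
  refine add_le_add (hbound A₁ ?_ ?_) (hbound A₂ ?_ ?_)
  · intro t ht
    rw [hA₁, Finset.mem_filter, hA, Finset.mem_filter] at ht
    exact d0_pos ht.1.2
  · intro a ha b hb h
    rw [Finset.mem_coe, hA₁, Finset.mem_filter] at ha hb
    have hda : d0 a = a.val := by unfold d0; rw [min_eq_left ha.2]
    have hdb : d0 b = b.val := by unfold d0; rw [min_eq_left hb.2]
    apply ZMod.val_injective q
    rw [← hda, ← hdb]; exact h
  · intro t ht
    rw [hA₂, Finset.mem_filter, hA, Finset.mem_filter] at ht
    exact d0_pos ht.1.2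
  · intro a ha b hb h
    rw [Finset.mem_coe, hA₂, Finset.mem_filter] at ha hb
    have hva : a.val < q := ZMod.val_lt a
    have hvb : b.val < q := ZMod.val_lt b
    have hda : d0 a = q - a.val := by unfold d0; rw [min_eq_right (by omega)]
    have hdb : d0 b = q - b.val := by unfold d0; rw [min_eq_right (by omega)]
    apply ZMod.val_injective q
    rw [hda, hdb] at h
    have : d0 a = d0 a := rfl
    omega

/-! ### The `(4.7)`-shaped bound from the abstract Lemma 4 -/

/-- `((crep(āk))², q) = ((d0 k)², q)` for a unit `ā`. [folklore] -/
theorem gcd_crep_unit_mul_sq {u : ZMod q} (hu : IsUnit u) (k : ZMod q) :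
    Nat.gcd ((crep (u * k)) ^ 2).natAbs q = Nat.gcd ((d0 k) ^ 2) q := by
  have h1 : Nat.gcd ((crep (u * k)) ^ 2).natAbs q = Nat.gcd ((u * k) ^ 2).val q := by
    rw [← gcd_val_intCast]; push_cast; rw [crep_cast]
  have h2 : Nat.gcd ((u * k) ^ 2).val q = Nat.gcd (k ^ 2).val q := by
    rw [show (u * k) ^ 2 = u ^ 2 * k ^ 2 by ring]; exact gcd_val_unit_mul (hu.pow 2) _
  have h3 : Nat.gcd (k ^ 2).val q = Nat.gcd ((crep k) ^ 2).natAbs q := by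
    rw [← gcd_val_intCast]; push_cast; rw [crep_cast]
  rw [h1, h2, h3, Int.natAbs_pow, natAbs_crep]

/-- **HB (4.7), abstract form.** If `|S(k, t₁, t₂, ρ, σ; q)| ≤ A₄ · L4shape` for all integer parameters
(Lemma 4 with `A₄ = d_A(q) q^{5/2}`), then for a unit `a`, integers `ρ̃, σ̃`, residues `t₁, t₂` and `N`,
`|∑*_{1 ≤ h < N} K₂(ρ̃,σ̃,aht₁) conj K₂(ρ̃,σ̃,aht₂)| ≤
  A₄ √((ρ̃,q)(σ̃,q)) · √((t₁,q)(t₂,q)) (t₁−t₂,q) · (N q^{-5/6} + d(q)(1 + log q))`.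
[cite: HeathBrown1986d3, §4 (4.6)–(4.7)] -/
theorem KK_bound_of_L4 {A₄ : ℝ} (hA₄ : 0 ≤ A₄)
    (hL4 : ∀ k t₁ t₂ ρ σ : ℤ, ‖SS q (k : ZMod q) (t₁ : ZMod q) (t₂ : ZMod q) (ρ : ZMod q) (σ : ZMod q)‖ ≤
      A₄ * L4shape q k t₁ t₂ ρ σ)
    {a : ZMod q} (ha : IsUnit a) (ρt σt : ℤ) (t₁ t₂ : ZMod q) (N : ℕ) :
    ‖∑ h ∈ (Finset.Ico 1 N).filter (fun h : ℕ => IsUnit ((h : ℕ) : ZMod q)),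
        K2 q (ρt : ZMod q) (σt : ZMod q) (a * ((h : ℕ) : ZMod q) * t₁) *
          starRingEnd ℂ (K2 q (ρt : ZMod q) (σt : ZMod q) (a * ((h : ℕ) : ZMod q) * t₂))‖ ≤
      A₄ * Real.sqrt ((Nat.gcd ρt.natAbs q : ℝ) * (Nat.gcd σt.natAbs q)) *
        (Real.sqrt ((Nat.gcd t₁.val q : ℝ) * (Nat.gcd t₂.val q)) * (Nat.gcd (t₁ - t₂).val q : ℝ)) *
        ((N : ℝ) * (q : ℝ) ^ (-(5 / 6 : ℝ)) + (Nat.divisors q).card * (1 + Real.log q)) := by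
  classical
  have hq : q ≠ 0 := NeZero.ne q
  have hq0 : (0 : ℝ) < q := by exact_mod_cast Nat.pos_of_ne_zero hq
  set X := Real.sqrt ((Nat.gcd t₁.val q : ℝ) * (Nat.gcd t₂.val q)) *
    Real.sqrt ((Nat.gcd ρt.natAbs q : ℝ) * (Nat.gcd σt.natAbs q)) * (Nat.gcd (t₁ - t₂).val q : ℝ) with hX
  have hX0 : 0 ≤ X := by positivity
  set G : ZMod q → ℂ := fun k => ∑ h ∈ Finset.Ioc 0 (N - 1), (ZMod.stdAddChar (-(k * ((h : ℕ) : ZMod q))) : ℂ) with hG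
  -- Step 1: the interval and B1
  have hIco : Finset.Ico 1 N = Finset.Ioc 0 (N - 1) := by
    ext h; simp only [Finset.mem_Ico, Finset.mem_Ioc]; omega
  have hB1 := mul_sum_K2_conj_eq_sum_SS a ha (ρt : ZMod q) (σt : ZMod q) t₁ t₂ 0 (N - 1)
  rw [Finset.sum_filter, hIco]
  have hqC : (q : ℂ) ≠ 0 := by exact_mod_cast hq
  have hLHS : ∑ h ∈ Finset.Ioc 0 (N - 1), (if IsUnit ((h : ℕ) : ZMod q) then
      K2 q (ρt : ZMod q) (σt : ZMod q) (a * ((h : ℕ) : ZMod q) * t₁) *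
        starRingEnd ℂ (K2 q (ρt : ZMod q) (σt : ZMod q) (a * ((h : ℕ) : ZMod q) * t₂)) else 0) =
      (q : ℂ)⁻¹ * ∑ k : ZMod q, SS q (a⁻¹ * k) t₁ t₂ (ρt : ZMod q) (σt : ZMod q) * G k := by
    rw [← hB1, ← mul_assoc, inv_mul_cancel₀ hqC, one_mul]
  rw [hLHS, norm_mul, norm_inv, Complex.norm_natCast]
  -- Step 2: the `G`-bounds
  have hG0 : ‖G 0‖ ≤ N := by
    simp only [hG, zero_mul, neg_zero, AddChar.map_zero_eq_one, Finset.sum_const, Nat.card_Ioc, nsmul_eq_mul,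
      mul_one]
    rw [Complex.norm_natCast]
    exact_mod_cast Nat.sub_le N 1
  have hGk : ∀ k : ZMod q, k ≠ 0 → ‖G k‖ ≤ (q : ℝ) / (2 * d0 k) := by
    intro k hk
    have e : G k = ∑ h ∈ Finset.Ioc 0 (N - 1), (ZMod.stdAddChar ((-k) * ((h : ℕ) : ZMod q)) : ℂ) := by
      simp only [hG]; refine Finset.sum_congr rfl fun h _ => by rw [neg_mul]
    rw [e]
    have := norm_sum_Ioc_nat_stdAddChar_le (neg_ne_zero.mpr hk) (N - 1)
    rwa [d0_neg] at this
  -- Step 3: the `S`-bounds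
  have hS0 : ‖SS q (a⁻¹ * 0) t₁ t₂ (ρt : ZMod q) (σt : ZMod q)‖ ≤ A₄ * ((q : ℝ) ^ (1 / 6 : ℝ) * X) := by
    have h := hL4 0 (t₁.val : ℤ) (t₂.val : ℤ) ρt σt
    simp only [Int.cast_zero, Int.cast_natCast, ZMod.natCast_zmod_val] at h
    rw [mul_zero]
    refine h.trans (mul_le_mul_of_nonneg_left ?_ hA₄)
    exact (L4shape_zero_le t₁ t₂ ρt σt).trans (le_of_eq (by rw [hX]))
  have hSk : ∀ k : ZMod q, k ≠ 0 → ‖SS q (a⁻¹ * k) t₁ t₂ (ρt : ZMod q) (σt : ZMod q)‖ ≤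
      A₄ * (Real.sqrt (Nat.gcd ((d0 k) ^ 2) q : ℝ) * X) := by
    intro k _
    have h := hL4 (crep (a⁻¹ * k)) (t₁.val : ℤ) (t₂.val : ℤ) ρt σt
    simp only [crep_cast, Int.cast_natCast, ZMod.natCast_zmod_val] at h
    refine h.trans (mul_le_mul_of_nonneg_left ?_ hA₄)
    refine (L4shape_le (crep (a⁻¹ * k)) t₁ t₂ ρt σt).trans (le_of_eq ?_)
    have hu : IsUnit a⁻¹ := by
      refine ⟨⟨a⁻¹, a, ZMod.inv_mul_of_unit a ha, ZMod.mul_inv_of_unit a ha⟩, rfl⟩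
    rw [gcd_crep_unit_mul_sq hu k, hX]
  -- Step 4: split off `k = 0` and bound
  have hsplit : ∑ k : ZMod q, SS q (a⁻¹ * k) t₁ t₂ (ρt : ZMod q) (σt : ZMod q) * G k =
      SS q (a⁻¹ * 0) t₁ t₂ (ρt : ZMod q) (σt : ZMod q) * G 0 +
        ∑ k ∈ (Finset.univ : Finset (ZMod q)).filter (fun k => k ≠ 0),
          SS q (a⁻¹ * k) t₁ t₂ (ρt : ZMod q) (σt : ZMod q) * G k := by
    rw [← Finset.add_sum_erase _ _ (Finset.mem_univ (0 : ZMod q)), Finset.filter_ne']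
  have hterm0 : ‖SS q (a⁻¹ * 0) t₁ t₂ (ρt : ZMod q) (σt : ZMod q) * G 0‖ ≤ A₄ * ((q : ℝ) ^ (1 / 6 : ℝ) * X) * N := by
    rw [norm_mul]; exact mul_le_mul hS0 hG0 (norm_nonneg _) (by positivity)
  have htermk : ∀ k ∈ (Finset.univ : Finset (ZMod q)).filter (fun k => k ≠ 0),
      ‖SS q (a⁻¹ * k) t₁ t₂ (ρt : ZMod q) (σt : ZMod q) * G k‖ ≤
        A₄ * X * ((q : ℝ) / 2) * (Real.sqrt (Nat.gcd ((d0 k) ^ 2) q : ℝ) / d0 k) := by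
    intro k hk
    have hk0 : k ≠ 0 := (Finset.mem_filter.mp hk).2
    have hd : (0 : ℝ) < d0 k := by exact_mod_cast d0_pos hk0
    rw [norm_mul]
    calc ‖SS q (a⁻¹ * k) t₁ t₂ (ρt : ZMod q) (σt : ZMod q)‖ * ‖G k‖
        ≤ (A₄ * (Real.sqrt (Nat.gcd ((d0 k) ^ 2) q : ℝ) * X)) * ((q : ℝ) / (2 * d0 k)) :=
          mul_le_mul (hSk k hk0) (hGk k hk0) (norm_nonneg _) (by positivity)
      _ = _ := by field_simp
  have hsumk : ∑ k ∈ (Finset.univ : Finset (ZMod q)).filter (fun k => k ≠ 0),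
      ‖SS q (a⁻¹ * k) t₁ t₂ (ρt : ZMod q) (σt : ZMod q) * G k‖ ≤
        A₄ * X * (q : ℝ) * ((Nat.divisors q).card * (1 + Real.log q)) := by
    refine (Finset.sum_le_sum htermk).trans ?_
    rw [← Finset.mul_sum]
    have hfold := sum_ne_zero_d0_le (q := q) (fun m => Real.sqrt (Nat.gcd (m ^ 2) q : ℝ) / m) (fun m => by positivity)
    have hB2 := sum_sqrt_gcd_sq_div_le q q hq
    calc A₄ * X * ((q : ℝ) / 2) * ∑ k ∈ (Finset.univ : Finset (ZMod q)).filter (fun k => k ≠ 0),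
          Real.sqrt (Nat.gcd ((d0 k) ^ 2) q : ℝ) / d0 k
        ≤ A₄ * X * ((q : ℝ) / 2) * (2 * ((Nat.divisors q).card * (1 + Real.log q))) := by
          refine mul_le_mul_of_nonneg_left (hfold.trans ?_) (by positivity)
          exact mul_le_mul_of_nonneg_left hB2 (by norm_num)
      _ = _ := by ring
  -- Step 5: assemble
  have hq16 : (q : ℝ)⁻¹ * (q : ℝ) ^ (1 / 6 : ℝ) = (q : ℝ) ^ (-(5 / 6 : ℝ)) := by
    rw [← Real.rpow_neg_one, ← Real.rpow_add hq0]; norm_num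
  calc (q : ℝ)⁻¹ * ‖∑ k : ZMod q, SS q (a⁻¹ * k) t₁ t₂ (ρt : ZMod q) (σt : ZMod q) * G k‖
      ≤ (q : ℝ)⁻¹ * (A₄ * ((q : ℝ) ^ (1 / 6 : ℝ) * X) * N + A₄ * X * (q : ℝ) * ((Nat.divisors q).card * (1 + Real.log q))) := by
        refine mul_le_mul_of_nonneg_left ?_ (inv_nonneg.mpr hq0.le)
        rw [hsplit]
        exact (norm_add_le _ _).trans (add_le_add hterm0 ((norm_sum_le _ _).trans hsumk))
    _ = A₄ * Real.sqrt ((Nat.gcd ρt.natAbs q : ℝ) * (Nat.gcd σt.natAbs q)) *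
        (Real.sqrt ((Nat.gcd t₁.val q : ℝ) * (Nat.gcd t₂.val q)) * (Nat.gcd (t₁ - t₂).val q : ℝ)) *
        ((N : ℝ) * ((q : ℝ)⁻¹ * (q : ℝ) ^ (1 / 6 : ℝ)) + (Nat.divisors q).card * (1 + Real.log q)) := by
        rw [hX]; field_simp
    _ = _ := by rw [hq16]

/-! ### The diagonal hypothesis from Deligne's bound (HB (3.1)) -/

/-- **`|K₂(ρ̃, σ̃, c; q)|² ≤ (q d₃(q))² (ρ̃, q)(σ̃, q)`**, from Deligne's prime bound `|K₂(a;p)| ≤ 3p`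
(`p ∤ a₁a₂a₃`) via `K2_bound_of_deligne` (HB (3.1): `|K₂(a;q)| ≤ q d₃(q) (a₁,a₂,a₃,q)`) and
`(a₁,a₂,a₃,q)² ≤ (a₁,q)(a₂,q)`. [cite: HeathBrown1986d3, (3.1)] -/
theorem K2_sq_le_of_deligne
    (hD : ∀ (p : ℕ) [Fact p.Prime] (a₁ a₂ a₃ : ZMod p), a₁ ≠ 0 → a₂ ≠ 0 → a₃ ≠ 0 → ‖K2 p a₁ a₂ a₃‖ ≤ 3 * p)
    (ρt σt : ℤ) (c : ZMod q) :
    ‖K2 q (ρt : ZMod q) (σt : ZMod q) c‖ ^ 2 ≤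
      ((q : ℝ) * d3 q) ^ 2 * ((Nat.gcd ρt.natAbs q : ℝ) * (Nat.gcd σt.natAbs q)) := by
  have hq : q ≠ 0 := NeZero.ne q
  have h := K2_bound_of_deligne hD q (ρt : ZMod q) (σt : ZMod q) c
  set g := Nat.gcd (Nat.gcd (Nat.gcd ((ρt : ZMod q)).val ((σt : ZMod q)).val) c.val) q with hg
  have hg1 : g ∣ Nat.gcd ρt.natAbs q := by
    rw [← gcd_val_intCast]
    exact Nat.dvd_gcd (((Nat.gcd_dvd_left _ _).trans (Nat.gcd_dvd_left _ _)).trans (Nat.gcd_dvd_left _ _))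
      (Nat.gcd_dvd_right _ _)
  have hg2 : g ∣ Nat.gcd σt.natAbs q := by
    rw [← gcd_val_intCast]
    exact Nat.dvd_gcd (((Nat.gcd_dvd_left _ _).trans (Nat.gcd_dvd_left _ _)).trans (Nat.gcd_dvd_right _ _))
      (Nat.gcd_dvd_right _ _)
  have hpos1 : 0 < Nat.gcd ρt.natAbs q := Nat.pos_of_ne_zero (Nat.gcd_ne_zero_right hq)
  have hpos2 : 0 < Nat.gcd σt.natAbs q := Nat.pos_of_ne_zero (Nat.gcd_ne_zero_right hq)
  have hgg : ((g : ℝ)) ^ 2 ≤ (Nat.gcd ρt.natAbs q : ℝ) * (Nat.gcd σt.natAbs q) := by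
    rw [sq]; exact_mod_cast Nat.mul_le_mul (Nat.le_of_dvd hpos1 hg1) (Nat.le_of_dvd hpos2 hg2)
  have h0 : 0 ≤ ‖K2 q (ρt : ZMod q) (σt : ZMod q) c‖ := norm_nonneg _
  calc ‖K2 q (ρt : ZMod q) (σt : ZMod q) c‖ ^ 2 ≤ ((q : ℝ) * g * d3 q) ^ 2 := by
        exact pow_le_pow_left₀ h0 h 2
    _ = ((q : ℝ) * d3 q) ^ 2 * (g : ℝ) ^ 2 := by ring
    _ ≤ ((q : ℝ) * d3 q) ^ 2 * ((Nat.gcd ρt.natAbs q : ℝ) * (Nat.gcd σt.natAbs q)) :=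
        mul_le_mul_of_nonneg_left hgg (sq_nonneg _)



end Literature.NumberTheory.Sieve.HeathBrown1986
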